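import Literature.Barriers.CriticalPhenomena.PositionSpaceRGNonGibbsianSpacingSelection
import Literature.Barriers.CriticalPhenomena.PositionSpaceRGNonGibbsianCore
import HarnessLib

/-!
# Barrier `PositionSpaceRGNonGibbsian`, Theorem 4.3 (decimation with spacing `b ≥ 2`):
# the phase-selection / screening step `VEFS1993_screening` (§4.3.1 Steps 2.1–2.2) — proved

Companion ("Proofs") file of
`Literature/Barriers/CriticalPhenomena/PositionSpaceRGNonGibbsianSpacingSelection.lean`
(van Enter–Fernández–Sokal, J. Stat. Phys. **72** (1993) 879, arXiv:hep-lat/9210032), which split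
the extremal finite-volume estimate of Theorem 4.3 into the named facts `VEFS1993_screening`
(Steps 2.1–2.2: "`μ^{±,+,σ}_{R,R'}` converges as `R' → ∞` to a Gibbs measure for the system
`⟨R;∞;±;+⟩`"; "The system `⟨R;∞;±;+⟩` has a unique Gibbs measure") and `VEFS1993_plusPhase`
(Pirogov–Sinai). Here `VEFS1993_screening` is DISCHARGED (`VEFS1993_screening_holds`), for every
spacing `b ≥ 2`, every dimension, and in fact at every `β > 0` (threshold `J₁ = 0`; the source,
Step 2.2, p. 110: "We only need uniqueness at low enough temperature, but in fact the Gibbs measure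
is unique at all temperatures").

## The printed argument (§4.3.1 Step 2.2, pp. 110–111) and the route taken here

"First, we notice that it is enough to prove uniqueness of the Gibbs measure when all the image
spins (including those inside `Λ_R`) are set in the '+' position. Indeed, changing the image spins
inside `Λ_R` amounts to a finite-volume perturbation of the system and hence it does not alter the
number of Gibbs measures [157, section 7.4]. [In fact, every Gibbs measure `μ'` for the perturbed
interaction comes from a uniquely defined Gibbs measure `μ` of the unperturbed interaction: if `W`
is the perturbation, then `μ'(·) = μ(· e^{-W})/μ(e^{-W})`.] To prove the uniqueness of the Gibbs
measure for the system with all image spins '+', we provide two arguments. First argument …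
Pirogov–Sinai theory … Second argument, proving uniqueness at all temperatures: The internal-spin
system is an Ising model on a periodic lattice, with nearest-neighbor coupling `J > 0` and a
periodic magnetic field `h_x = h δ^{n.i.}_x` (here `δ^{n.i.}_x = 1` if `x` neighbors an image
spin, and `0` otherwise), specialized to `h = +J`. By the Lee–Yang theorem … the pressure … is a
jointly analytic function … (4.28)–(4.31) … hence there is a unique Gibbs measure at all
temperatures. (This argument is essentially due to Lebowitz [236, 237] …)"; §4.3.2 (p. 113):
"Steps 2 and 3 are then proven in a manner exactly identical to the `b = 2` case."

As for `b = 2` (`PositionSpaceRGNonGibbsianCore.lean`), the Lee–Yang input is replaced by the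
tree's GHS/convexity uniqueness theorem at the sites carrying a positive periodic field
(`exists_volume_plusMag_sub_minusMag_le`, Friedli–Velenik Remark 3.41 / Theorem 3.34, Preston
1974), which is all that is needed: the observables met below live on field sites. Concretely,
for the finite-volume statement `VEFS1993_screening` (the expectation of `σ_0` in
`W(R') = Λ^int_{R'} ∪ {0}` with image spins `p·ω'_alt` on `Λ_R`, `+1` on the annulus, and all-`+`
versus all-`-` exterior):

1. **Unfixing the origin** (§4.1.2 Step 3, (4.7)–(4.9); DLR in the volume for
   `Λ^int_{R'} ⊆ W(R')`): `⟨σ_0⟩^{ζ}_{ℤ^d;W(R');β,0} = (Z₊ - Z₋)/(Z₊ + Z₋)`, `Z_s` the zero-field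
   partition function of `Λ^int_{R'}` with boundary condition `ζ[0 ↦ s]`
   (`isingExpect_spinAt_zero_spacingVolume_eq`).
2. **The bridge** to the internal-spin system: on a volume of internal sites the zero-field
   Hamiltonian of `ℤ^d` with the image spins frozen to `ξ` is the Hamiltonian of the `b`-diluted
   graph `𝔻_b` (`spDilutedGraph`) with the site-dependent field `h^ξ_k = ∑_{a ∼ k image} ξ_a`
   (`imgField`; `isingPartitionFunction_zd_eq_fieldZ_spDiluted`) — "an Ising model on a periodic
   lattice … with a periodic magnetic field".
3. **The finite-volume perturbation** (Step 2.2): on `Λ^int_{R'}` the field of `ζ_{R'}[0↦s]` is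
   that of the `R'`-independent configuration `spCoreConfig` (core pattern, `s` at the origin, `+1`
   elsewhere), which differs from the periodic all-`+` field `h⁺ = imgField 1` only on the finite
   set `spCoreSites` of internal sites next to the core image sites; the boundary condition is `±1`
   on the outer boundary; hence `Z_s = Z^{±}_{𝔻_b;Λ^int_{R'};h⁺} · ⟨T_s⟩^{±}_{𝔻_b;Λ^int_{R'};h⁺}` with
   the core-local tilt `T_s = e^{β∑(h^{η_s}-h⁺)σ}` (`isingPartitionFunction_update_eq_fieldZ_mul`),
   and `⟨σ_0⟩ = (⟨T₊⟩ - ⟨T₋⟩)/(⟨T₊⟩ + ⟨T₋⟩)` (`isingExpect_spinAt_zero_eq_tilt_ratio`).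
4. **Uniqueness at the field sites of the periodic system `⟨∞;+⟩`** (Step 2.2): the period-`b`
   translations are automorphisms of `𝔻_b` preserving `h⁺`, the cells `{0,…,b-1}^d + bz` tile van
   Hove cubes, so `exists_volume_plusMag_sub_minusMag_le` gives
   `⟨σ_k⟩⁺_{Λ;h⁺} - ⟨σ_k⟩⁻_{Λ;h⁺} ≤ ε` for `Λ ⊇ Λ₀(k,ε)` at every field site `k`, whence along
   `Λ^int_{R'}` (`tendsto_plusMag_sub_minusMag_spacingIntVolume`), and, by the FKG trick of
   Friedli–Velenik Lemma 3.33 (`tendsto_fieldExpect_plus_sub_minus_of_local`), insensitivity of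
   every core-local observable — in particular of `⟨T_±⟩` — to the `±` boundary condition
   (`tendsto_per_plus_sub_minus_spacing`).
5. **Screening**: the two ratios in 3. for the `+` and `-` exterior are then close
   (`tendsto_isingExpect_spinAt_zero_plus_sub_minus`), which is `VEFS1993_screening` with
   `J₁ = 0` (`VEFS1993_screening_holds`).

Nothing is asserted: the file is sorry-free and introduces no named fact (D-0014, D-0026); the new
definitions (`IsSpImageSite`, `spDilutedGraph`, `imgNbrs`, `imgField`, `spacingIntVolume`,
`spCoreConfig`, `spCoreSites`, `spShift`, `spTiledCube`, `spCoreTilt`, `spCoreTiltExp`) are the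
spacing-`b` counterparts of the `b = 2` objects of `…Diluted.lean` / `…Core.lean`
(`IsDecimatedSite`, `dilutedGraph`, `decNbrs`, `decField`, `gpiVolume'`, `nearSites`, `evenShift`,
`tiledCube`, `nearTilt`), which are hard-wired to `2`.

## References

* A. C. D. van Enter, R. Fernández, A. D. Sokal, *Regularity properties and pathologies of
  position-space renormalization-group transformations: scope and limitations of Gibbsian
  theory*, J. Stat. Phys. 72 (1993) 879–1167, arXiv:hep-lat/9210032 — §4.1.2 Step 3
  (eqs. (4.7)–(4.9)), §4.3.1 Step 2 (pp. 108–112, eqs. (4.26)–(4.31)), §4.3.2 (pp. 112–113)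
  [VanenterFernandezSokal1993].
* S. Friedli, Y. Velenik, *Statistical Mechanics of Lattice Systems* (CUP 2017), §3.2.1,
  Lemma 3.33, Theorem 3.34, Remark 3.41, Lemma 6.7 [FriedliVelenik2017].
-/

noncomputable section

namespace Literature.Barriers.CriticalPhenomena.NonGibbs

open MeasureTheory Finset Filter Topology Literature.Probability.LatticeModels

variable {d : ℕ}

/-! ### Image sites of spacing `b` and the `b`-diluted graph of internal spins -/

variable (d) in
/-- A site of `ℤ^d` is an **image site for the decimation of spacing `b`** (§3.1.2 eq. (3.7):
the image spins live on `bℤ^d`) if all its coordinates are divisible by `b`.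
[cite: VanenterFernandezSokal1993, §3.1.2 eq. (3.7)] -/
def IsSpImageSite (b : ℕ) (x : Site d) : Prop := ∀ i, (b : ℤ) ∣ x i

/-- Being an image site is decidable. [folklore] -/
instance (b : ℕ) (x : Site d) : Decidable (IsSpImageSite d b x) :=
  inferInstanceAs (Decidable (∀ i, (b : ℤ) ∣ x i))

variable (d) in
/-- **The internal-spin graph for spacing `b`** (§4.3.1 Step 2 / §4.3.2: "an Ising model on a
periodic lattice", the internal spins `(ℤ^d)_int = ℤ^d ∖ bℤ^d` with their nearest-neighbour
bonds): the nearest-neighbour graph of `ℤ^d` restricted to the internal sites; image sites are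
isolated vertices. [cite: VanenterFernandezSokal1993, §4.3.1 Step 2.2 and §4.3.2] -/
def spDilutedGraph (b : ℕ) : SimpleGraph (Site d) where
  Adj x y := (zdGraph d).Adj x y ∧ ¬ IsSpImageSite d b x ∧ ¬ IsSpImageSite d b y
  symm := ⟨fun _ _ h => ⟨h.1.symm, h.2.2, h.2.1⟩⟩
  loopless := ⟨fun _ h => h.1.ne rfl⟩

/-- Adjacency in the `b`-diluted graph is decidable. [folklore] -/
instance (b : ℕ) : DecidableRel (spDilutedGraph d b).Adj := fun x y =>
  inferInstanceAs (Decidable ((zdGraph d).Adj x y ∧ ¬ IsSpImageSite d b x ∧ ¬ IsSpImageSite d b y))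

/-- The `b`-diluted graph is a subgraph of `ℤ^d`. [cite: VanenterFernandezSokal1993, §4.3.1 Step 2.2] -/
theorem spDilutedGraph_le (b : ℕ) : spDilutedGraph d b ≤ zdGraph d := fun _ _ h => h.1

/-- The `b`-diluted graph is locally finite. [cite: VanenterFernandezSokal1993, §4.3.1 Step 2.2] -/
instance (b : ℕ) : (spDilutedGraph d b).LocallyFinite := fun x =>
  Fintype.ofFinset (((zdGraph d).neighborFinset x).filter fun y =>
      ¬ IsSpImageSite d b x ∧ ¬ IsSpImageSite d b y)
    (by
      intro y
      simp only [Finset.mem_filter, SimpleGraph.mem_neighborFinset, SimpleGraph.mem_neighborSet]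
      rfl)

/-- Adjacency in the `b`-diluted graph. [cite: VanenterFernandezSokal1993, §4.3.1 Step 2.2] -/
theorem spDilutedGraph_adj {b : ℕ} {x y : Site d} :
    (spDilutedGraph d b).Adj x y ↔ (zdGraph d).Adj x y ∧ ¬ IsSpImageSite d b x ∧ ¬ IsSpImageSite d b y :=
  Iff.rfl

variable (d) in
/-- **The image neighbours** of a site (the image spins an internal spin is coupled to; §4.3.2:
"the sites neighboring an image spin"). [cite: VanenterFernandezSokal1993, §4.3.2] -/
def imgNbrs (b : ℕ) (k : Site d) : Finset (Site d) :=
  ((zdGraph d).neighborFinset k).filter (IsSpImageSite d b)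

/-- Membership in `imgNbrs`. [cite: VanenterFernandezSokal1993, §4.3.2] -/
theorem mem_imgNbrs {b : ℕ} {k a : Site d} :
    a ∈ imgNbrs d b k ↔ (zdGraph d).Adj k a ∧ IsSpImageSite d b a := by
  simp [imgNbrs]

variable (d) in
/-- **The field induced on a site by the frozen image spins** `ξ` for spacing `b`:
`h^ξ_k = ∑_{a ∼ k, a ∈ bℤ^d} ξ_a` ("each internal spin … feels an 'effective magnetic field' from
each image spin adjacent to it", §4.1.2 Step 2; §4.3.2: "a periodic … magnetic field which is
nonzero at the sites neighboring an image spin"). [cite: VanenterFernandezSokal1993, §4.1.2 Step 2 and §4.3.2] -/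
def imgField (b : ℕ) (ξ : SpinConfig (Site d)) (k : Site d) : ℝ :=
  ∑ a ∈ imgNbrs d b k, spinAt a ξ

/-! ### Elementary geometry of the image sites -/

/-- The origin is an image site. [cite: VanenterFernandezSokal1993, §3.1.2 eq. (3.7)] -/
theorem isSpImageSite_zero (b : ℕ) : IsSpImageSite d b 0 := fun i => by simp

/-- For `b ≥ 2` two image sites are never adjacent: a neighbour of an image site is internal.
[cite: VanenterFernandezSokal1993, §4.1.2 Step 1] -/
theorem not_isSpImageSite_of_adj {b : ℕ} (hb : 2 ≤ b) {x y : Site d} (hx : IsSpImageSite d b x)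
    (hxy : (zdGraph d).Adj x y) : ¬ IsSpImageSite d b y := by
  intro hy
  obtain ⟨i, h | h⟩ := (zdGraph_adj_iff x y).1 hxy
  · have h1 : y i = x i + 1 := by
      have := congrFun h i; simpa using this
    have hdvd : (b : ℤ) ∣ 1 := by
      have := dvd_sub (hy i) (hx i)
      rwa [h1, add_sub_cancel_left] at this
    have hb1 : (b : ℤ) ≤ 1 := Int.le_of_dvd one_pos hdvd
    omega
  · have h1 : x i = y i + 1 := by
      have := congrFun h i; simpa using this
    have hdvd : (b : ℤ) ∣ 1 := by
      have := dvd_sub (hx i) (hy i)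
      rwa [h1, add_sub_cancel_left] at this
    have hb1 : (b : ℤ) ≤ 1 := Int.le_of_dvd one_pos hdvd
    omega

/-- For `b ≥ 2` the neighbours of the origin are internal sites.
[cite: VanenterFernandezSokal1993, §4.1.2 Step 3] -/
theorem not_isSpImageSite_of_adj_zero {b : ℕ} (hb : 2 ≤ b) {y : Site d} (hy : (zdGraph d).Adj 0 y) :
    ¬ IsSpImageSite d b y :=
  not_isSpImageSite_of_adj hb (isSpImageSite_zero b) hy

/-- A site with an image neighbour is internal (`b ≥ 2`). [cite: VanenterFernandezSokal1993, §4.1.2 Step 1] -/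
theorem not_isSpImageSite_of_mem_imgNbrs {b : ℕ} (hb : 2 ≤ b) {k a : Site d} (ha : a ∈ imgNbrs d b k) :
    ¬ IsSpImageSite d b k := by
  obtain ⟨hadj, himg⟩ := mem_imgNbrs.1 ha
  exact not_isSpImageSite_of_adj hb himg hadj.symm

/-- An image site is `b` times its quotient. [cite: VanenterFernandezSokal1993, §3.1.2 eq. (3.7)] -/
theorem eq_mul_ediv_of_isSpImageSite {b : ℕ} {a : Site d} (ha : IsSpImageSite d b a) :
    a = fun i => (b : ℤ) * (a i / b) :=
  funext fun i => (Int.mul_ediv_cancel' (ha i)).symm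

/-- Image sites are stable under the translations `x ↦ x + b z`.
[cite: VanenterFernandezSokal1993, §4.3.2 ("periodic lattice")] -/
theorem isSpImageSite_add_smul {b : ℕ} (x z : Site d) :
    IsSpImageSite d b (x + (b : ℤ) • z) ↔ IsSpImageSite d b x := by
  refine forall_congr' fun i => ?_
  simp only [Pi.add_apply, Pi.smul_apply, smul_eq_mul]
  exact dvd_add_left (dvd_mul_right _ _)

/-- The outer boundary of a volume in the `b`-diluted graph consists of internal sites.
[cite: VanenterFernandezSokal1993, §4.3.1 Step 2] -/
theorem outerBoundary_spDilutedGraph_internal {b : ℕ} {Λ : Finset (Site d)} {y : Site d}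
    (hy : y ∈ outerBoundary (spDilutedGraph d b) Λ) : ¬ IsSpImageSite d b y := by
  obtain ⟨-, x, -, hxy⟩ := mem_outerBoundary_iff.1 hy
  exact hxy.2.1

/-- **Image neighbours of internal sites of the cube `Λ_{R'} = box d (bR')` lie in the cube**
(`b ≥ 2`): the outermost layer `|y_i| = bR' + 1` contains no image site.
[cite: VanenterFernandezSokal1993, §4.3.1 Step 2] -/
theorem mem_box_of_mem_imgNbrs {b : ℕ} (hb : 2 ≤ b) {R' : ℕ} {k a : Site d}
    (hk : k ∈ box d (b * R')) (ha : a ∈ imgNbrs d b k) : a ∈ box d (b * R') := by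
  obtain ⟨hadj, himg⟩ := mem_imgNbrs.1 ha
  rw [mem_box] at hk ⊢
  intro j
  obtain ⟨m, hm⟩ := himg j
  have hkj := hk j
  obtain ⟨i, h | h⟩ := (zdGraph_adj_iff k a).1 hadj
  · have haj : a j = k j + (Pi.single i (1 : ℤ) : Site d) j := by
      have := congrFun h j; simpa using this
    have hs : (Pi.single i (1 : ℤ) : Site d) j = 0 ∨ (Pi.single i (1 : ℤ) : Site d) j = 1 := by
      by_cases hji : j = i
      · subst hji; simp
      · simp [Pi.single_eq_of_ne hji]
    have hbR : ((b * R' : ℕ) : ℤ) = (b : ℤ) * R' := by push_cast; ring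
    rw [hbR] at hkj ⊢
    rcases hs with hs | hs
    · rw [hs, add_zero] at haj; rw [haj]; exact hkj
    · rw [hs] at haj
      -- `a j = k j + 1 = b m`; if `m ≥ R' + 1` then `b m ≥ b R' + b > b R' + 1`
      constructor
      · nlinarith
      · rw [hm]
        by_contra hcon
        push Not at hcon
        have hm' : (R' : ℤ) + 1 ≤ m := by
          by_contra h'; push Not at h'
          have : (b : ℤ) * m ≤ (b : ℤ) * R' := mul_le_mul_of_nonneg_left (by omega) (by positivity)
          exact absurd this (not_le.2 hcon)
        have : (b : ℤ) * ((R' : ℤ) + 1) ≤ (b : ℤ) * m := mul_le_mul_of_nonneg_left hm' (by positivity)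
        nlinarith
  · have haj : k j = a j + (Pi.single i (1 : ℤ) : Site d) j := by
      have := congrFun h j; simpa using this
    have hs : (Pi.single i (1 : ℤ) : Site d) j = 0 ∨ (Pi.single i (1 : ℤ) : Site d) j = 1 := by
      by_cases hji : j = i
      · subst hji; simp
      · simp [Pi.single_eq_of_ne hji]
    have hbR : ((b * R' : ℕ) : ℤ) = (b : ℤ) * R' := by push_cast; ring
    rw [hbR] at hkj ⊢
    rcases hs with hs | hs
    · rw [hs, add_zero] at haj; rw [← haj]; exact hkj
    · rw [hs] at haj
      constructor
      · rw [hm]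
        by_contra hcon
        push Not at hcon
        have hm' : m ≤ -((R' : ℤ) + 1) := by
          by_contra h'; push Not at h'
          have : (b : ℤ) * (-(R' : ℤ)) ≤ (b : ℤ) * m := mul_le_mul_of_nonneg_left (by omega) (by positivity)
          exact absurd this (not_le.2 (by linarith))
        have : (b : ℤ) * m ≤ (b : ℤ) * (-((R' : ℤ) + 1)) := mul_le_mul_of_nonneg_left hm' (by positivity)
        nlinarith
      · nlinarith


/-! ### The bridge: frozen image spins are a site-dependent field on the `b`-diluted graph -/

open Classical in
/-- The internal bonds at an internal volume: the edges of the `b`-diluted graph touching `Λ` are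
the edges of `ℤ^d` touching `Λ` with no image endpoint. [cite: VanenterFernandezSokal1993, §4.3.1 Step 2] -/
theorem edgesTouching_spDilutedGraph {b : ℕ} {Λ : Finset (Site d)} :
    edgesTouching (spDilutedGraph d b) Λ =
      (edgesTouching (zdGraph d) Λ).filter fun e => ∀ z ∈ e, ¬ IsSpImageSite d b z := by
  ext e
  rw [Finset.mem_filter, mem_edgesTouching_iff, mem_edgesTouching_iff]
  induction e using Sym2.ind with
  | _ u v =>
    simp only [SimpleGraph.mem_edgeSet, spDilutedGraph_adj, Sym2.mem_iff, forall_eq_or_imp,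
      forall_eq]
    exact ⟨fun ⟨⟨h1, h2, h3⟩, hx⟩ => ⟨⟨h1, hx⟩, h2, h3⟩, fun ⟨⟨h1, hx⟩, h2, h3⟩ => ⟨⟨h1, h2, h3⟩, hx⟩⟩

open Classical in
/-- The bonds of `ℤ^d` at an internal volume with an image endpoint are the pairs `{k, a}`,
`k ∈ Λ`, `a ∈ imgNbrs k` (each exactly once). [cite: VanenterFernandezSokal1993, §4.3.1 Step 2] -/
theorem edgesTouching_filter_img_eq_biUnion {b : ℕ} {Λ : Finset (Site d)}
    (hΛ : ∀ x ∈ Λ, ¬ IsSpImageSite d b x) :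
    (edgesTouching (zdGraph d) Λ).filter (fun e => ∃ z ∈ e, IsSpImageSite d b z) =
      Λ.biUnion fun k => (imgNbrs d b k).image fun a => s(k, a) := by
  ext e
  rw [Finset.mem_filter, mem_edgesTouching_iff, Finset.mem_biUnion]
  constructor
  · rintro ⟨⟨he, x, hx, hxe⟩, z, hze, hz⟩
    induction e using Sym2.ind with
    | _ u v =>
      have hadj : (zdGraph d).Adj u v := by simpa using he
      rcases Sym2.mem_iff.1 hxe with rfl | rfl
      · rcases Sym2.mem_iff.1 hze with rfl | rfl
        · exact absurd hz (hΛ _ hx)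
        · exact ⟨x, hx, Finset.mem_image.2 ⟨z, mem_imgNbrs.2 ⟨hadj, hz⟩, rfl⟩⟩
      · rcases Sym2.mem_iff.1 hze with rfl | rfl
        · exact ⟨x, hx, Finset.mem_image.2 ⟨z, mem_imgNbrs.2 ⟨hadj.symm, hz⟩, Sym2.eq_swap⟩⟩
        · exact absurd hz (hΛ _ hx)
  · rintro ⟨k, hk, hke⟩
    obtain ⟨a, ha, rfl⟩ := Finset.mem_image.1 hke
    obtain ⟨hadj, hdec⟩ := mem_imgNbrs.1 ha
    exact ⟨⟨by simpa using hadj, k, hk, Sym2.mem_mk_left _ _⟩, a, Sym2.mem_mk_right _ _, hdec⟩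

open Classical in
/-- **The bonds to the image sites are field terms**: on a configuration equal to `ξ` off the
internal volume `Λ`, `∑_{e at Λ with an image end} σ_e = ∑_{k ∈ Λ} h^ξ_k σ_k`.
[cite: VanenterFernandezSokal1993, §4.1.2 Step 2 and §4.3.2] -/
theorem sum_bondSpin_img_eq {b : ℕ} {Λ : Finset (Site d)} (hΛ : ∀ x ∈ Λ, ¬ IsSpImageSite d b x)
    (ξ σ : SpinConfig (Site d)) (hσ : ∀ x, x ∉ Λ → σ x = ξ x) :
    ∑ e ∈ (edgesTouching (zdGraph d) Λ).filter (fun e => ∃ z ∈ e, IsSpImageSite d b z), bondSpin σ e =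
      ∑ k ∈ Λ, imgField d b ξ k * spinAt k σ := by
  rw [edgesTouching_filter_img_eq_biUnion hΛ, Finset.sum_biUnion]
  · refine Finset.sum_congr rfl fun k hk => ?_
    rw [Finset.sum_image, imgField, Finset.sum_mul]
    · refine Finset.sum_congr rfl fun a ha => ?_
      obtain ⟨_, hdec⟩ := mem_imgNbrs.1 ha
      have haΛ : a ∉ Λ := fun h => hΛ a h hdec
      rw [bondSpin_mk, spinAt, spinAt, spinAt, hσ a haΛ]
      ring
    · intro a _ a' _ h
      exact Sym2.congr_right.1 h
  · intro k hk k' hk' hne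
    simp only [Function.onFun]
    rw [Finset.disjoint_left]
    intro e he he'
    obtain ⟨a, ha, rfl⟩ := Finset.mem_image.1 he
    obtain ⟨a', ha', h⟩ := Finset.mem_image.1 he'
    have hdec' := (mem_imgNbrs.1 ha').2
    rcases Sym2.eq_iff.1 h with ⟨h1, _⟩ | ⟨_, h2⟩
    · exact hne h1.symm
    · exact hΛ k (Finset.mem_coe.1 hk) (h2 ▸ hdec')

/-- **The Hamiltonians coincide**: for an internal volume `Λ` and `σ = ξ` off `Λ`,
`ℋ^{ξ}_{ℤ^d;Λ;0}(σ) = ℋ^{ξ}_{𝔻_b;Λ;h^ξ}(σ)`. [cite: VanenterFernandezSokal1993, §4.1.2 Steps 0–2 and §4.3.2] -/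
theorem isingHamiltonian_zd_eq_fieldHamiltonian_spDiluted {b : ℕ} {Λ : Finset (Site d)}
    (hΛ : ∀ x ∈ Λ, ¬ IsSpImageSite d b x) (ξ σ : SpinConfig (Site d))
    (hσ : ∀ x, x ∉ Λ → σ x = ξ x) :
    isingHamiltonian (zdGraph d) Λ 0 (.fixed ξ) σ =
      fieldHamiltonian (spDilutedGraph d b) Λ (imgField d b ξ) (.fixed ξ) σ := by
  classical
  simp only [isingHamiltonian, fieldHamiltonian, interactionEdges_fixed, zero_mul, sub_zero]
  rw [← Finset.sum_filter_add_sum_filter_not (edgesTouching (zdGraph d) Λ)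
    (fun e => ∃ z ∈ e, IsSpImageSite d b z), sum_bondSpin_img_eq hΛ ξ σ hσ,
    edgesTouching_spDilutedGraph]
  have hfilt : (edgesTouching (zdGraph d) Λ).filter (fun e => ¬ ∃ z ∈ e, IsSpImageSite d b z) =
      (edgesTouching (zdGraph d) Λ).filter (fun e => ∀ z ∈ e, ¬ IsSpImageSite d b z) :=
    Finset.filter_congr fun e _ => by push Not; exact Iff.rfl
  rw [hfilt]
  ring

/-- **The bridge for the Boltzmann weights**: for a volume `Λ` of internal sites and any frozen
configuration `ξ`, the zero-field weights of `ℤ^d` with boundary condition `ξ` are the weights of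
the `b`-diluted model with field `h^ξ = imgField ξ` and boundary condition `ξ`.
[cite: VanenterFernandezSokal1993, §4.1.2 Steps 0–2 and §4.3.2] -/
theorem isingWeight_zd_eq_fieldWeight_spDiluted {b : ℕ} {Λ : Finset (Site d)}
    (hΛ : ∀ x ∈ Λ, ¬ IsSpImageSite d b x) (β : ℝ) (ξ : SpinConfig (Site d)) (τ : Λ → ℤˣ) :
    isingWeight (zdGraph d) Λ β 0 (.fixed ξ) τ =
      fieldWeight (spDilutedGraph d b) Λ β (imgField d b ξ) (.fixed ξ) τ := by
  rw [isingWeight, fieldWeight, isingHamiltonian_zd_eq_fieldHamiltonian_spDiluted hΛ ξ _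
    (fun x hx => by rw [glue_apply_of_notMem _ _ _ hx]; rfl)]

/-- **The bridge for the partition functions**: `Z^{ξ}_{ℤ^d;Λ;β,0} = Z^{ξ}_{𝔻_b;Λ;β,h^ξ}` for an
internal volume `Λ`. [cite: VanenterFernandezSokal1993, §4.1.2 Steps 0–2 and §4.3.2] -/
theorem isingPartitionFunction_zd_eq_fieldZ_spDiluted {b : ℕ} {Λ : Finset (Site d)}
    (hΛ : ∀ x ∈ Λ, ¬ IsSpImageSite d b x) (β : ℝ) (ξ : SpinConfig (Site d)) :
    isingPartitionFunction (zdGraph d) Λ β 0 (.fixed ξ) =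
      fieldZ (spDilutedGraph d b) Λ β (imgField d b ξ) (.fixed ξ) := by
  simp only [isingPartitionFunction, fieldZ, isingWeight_zd_eq_fieldWeight_spDiluted hΛ]

/-- The partition function of the field model sees the boundary condition only through its
values on the outer boundary. [cite: FriedliVelenik2017, §3.6.3, eq. (3.26)] -/
theorem fieldZ_fixed_congr_outerBoundary {W : Type*} (G' : SimpleGraph W) [DecidableEq W]
    [G'.LocallyFinite] {Λ : Finset W} {η η' : SpinConfig W} (hη : ∀ y ∈ outerBoundary G' Λ, η y = η' y) (β : ℝ)
    (h : W → ℝ) : fieldZ G' Λ β h (.fixed η) = fieldZ G' Λ β h (.fixed η') :=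
  Finset.sum_congr rfl fun τ _ => fieldWeight_fixed_congr_outerBoundary G' hη β h τ

/-! ### The volume of internal sites `Λ^int_{R'} = W(R') ∖ {0}` -/

variable (d) in
/-- The internal sites of the cube `Λ_{R'} = box d (bR')`: `Λ^int_{R'} = W(R') ∖ {0}`.
[cite: VanenterFernandezSokal1993, §4.3.1 Step 2 ("the system of internal spins in volume `Λ^int_{R'}`")] -/
def spacingIntVolume (b R' : ℕ) : Finset (Site d) :=
  (box d (b * R')).filter fun y => ¬ IsSpImageSite d b y

/-- Sites of `Λ^int_{R'}` are internal. [cite: VanenterFernandezSokal1993, §4.3.1 Step 2] -/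
theorem not_isSpImageSite_of_mem_spacingIntVolume {b R' : ℕ} {x : Site d}
    (hx : x ∈ spacingIntVolume d b R') : ¬ IsSpImageSite d b x :=
  (Finset.mem_filter.1 hx).2

/-- Sites of `Λ^int_{R'}` lie in the cube. [cite: VanenterFernandezSokal1993, §4.3.1 Step 2] -/
theorem mem_box_of_mem_spacingIntVolume {b R' : ℕ} {x : Site d}
    (hx : x ∈ spacingIntVolume d b R') : x ∈ box d (b * R') :=
  (Finset.mem_filter.1 hx).1

/-- `Λ^int_{R'} ⊆ W(R')`. [cite: VanenterFernandezSokal1993, §4.3.1 Steps 2–3] -/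
theorem spacingIntVolume_subset (b R' : ℕ) : spacingIntVolume d b R' ⊆ spacingVolume d b R' :=
  fun _ hx => Finset.mem_filter.2 ⟨mem_box_of_mem_spacingIntVolume hx,
    Or.inr (not_isSpImageSite_of_mem_spacingIntVolume hx)⟩

/-- `W(R') ∖ Λ^int_{R'} = {0}`. [cite: VanenterFernandezSokal1993, §4.3.1 Steps 2–3] -/
theorem mem_spacingVolume_sdiff_iff {b R' : ℕ} {x : Site d} :
    x ∈ spacingVolume d b R' \ spacingIntVolume d b R' ↔ x = 0 := by
  simp only [Finset.mem_sdiff, spacingVolume, spacingIntVolume, Finset.mem_filter, not_and,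
    not_not, IsSpImageSite]
  constructor
  · rintro ⟨⟨hbox, h0 | hint⟩, h⟩
    · exact h0
    · exact absurd (h hbox) hint
  · rintro rfl
    exact ⟨⟨zero_mem_box d _, Or.inl rfl⟩, fun _ i => by simp⟩

/-- The volumes `Λ^int_{R'}` increase with `R'`. [cite: VanenterFernandezSokal1993, §4.3.1 Step 2.1] -/
theorem spacingIntVolume_mono (b : ℕ) : Monotone (spacingIntVolume d b) := fun R₁ R₂ h x hx => by
  rw [spacingIntVolume, Finset.mem_filter] at hx ⊢
  exact ⟨box_mono d (Nat.mul_le_mul_left b h) hx.1, hx.2⟩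

/-- For `b ≥ 2` and `R' ≥ 1` the neighbours of the origin lie in `Λ^int_{R'}`.
[cite: VanenterFernandezSokal1993, §4.1.2 Step 3] -/
theorem mem_spacingIntVolume_of_adj_zero {b R' : ℕ} (hb : 2 ≤ b) (hR' : 1 ≤ R') {y : Site d}
    (hy : (zdGraph d).Adj 0 y) : y ∈ spacingIntVolume d b R' := by
  refine Finset.mem_filter.2 ⟨?_, not_isSpImageSite_of_adj_zero hb hy⟩
  have h1 : y ∈ box d (0 + 1) := mem_box_succ_of_adj (zero_mem_box d 0) hy.symm
  exact box_mono d (by nlinarith) h1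

/-- Every finite set of internal sites is eventually inside the volumes `Λ^int_{R'}` (`b ≥ 1`).
[cite: VanenterFernandezSokal1993, §4.3.1 Step 2.1] -/
theorem eventually_subset_spacingIntVolume {b : ℕ} (hb : 1 ≤ b) (S : Finset (Site d))
    (hS : ∀ x ∈ S, ¬ IsSpImageSite d b x) : ∀ᶠ R' in atTop, S ⊆ spacingIntVolume d b R' := by
  obtain ⟨L₀, hL₀⟩ := exists_forall_subset_box d S
  refine eventually_atTop.2 ⟨L₀, fun R' hR' x hx => Finset.mem_filter.2 ⟨?_, hS x hx⟩⟩
  exact hL₀ (b * R') (le_trans hR' (by nlinarith)) hx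


/-- The origin is not in `Λ^int_{R'}`. [cite: VanenterFernandezSokal1993, §4.3.1 Step 3] -/
theorem zero_notMem_spacingIntVolume (b R' : ℕ) : (0 : Site d) ∉ spacingIntVolume d b R' :=
  fun h => not_isSpImageSite_of_mem_spacingIntVolume h (isSpImageSite_zero b)

/-- `0 ∈ W(R') ∖ Λ^int_{R'}`. [cite: VanenterFernandezSokal1993, §4.3.1 Step 3] -/
theorem zero_mem_spacingVolume_sdiff (b R' : ℕ) :
    (0 : Site d) ∈ spacingVolume d b R' \ spacingIntVolume d b R' :=
  mem_spacingVolume_sdiff_iff.2 rfl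

/-! ### Unfixing the origin: the expectation of `σ_0` in `W(R')` from the partition functions
of `Λ^int_{R'}` with the origin frozen to `±1` (§4.1.2 Step 3, eqs. (4.7)–(4.9)) -/

/-- For `b ≥ 2` and `R' ≥ 1` every bond of `ℤ^d` at `W(R')` already touches `Λ^int_{R'}` (the
bonds at the origin end at its internal neighbours). [cite: VanenterFernandezSokal1993, §4.1.2 Step 3] -/
theorem edgesTouching_spacingVolume_sdiff_eq_empty {b R' : ℕ} (hb : 2 ≤ b) (hR' : 1 ≤ R') :
    edgesTouching (zdGraph d) (spacingVolume d b R') \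
      edgesTouching (zdGraph d) (spacingIntVolume d b R') = ∅ := by
  refine Finset.eq_empty_of_forall_notMem fun e he => ?_
  obtain ⟨heW, heW₀⟩ := Finset.mem_sdiff.1 he
  obtain ⟨hE, x, hxW, hxe⟩ := mem_edgesTouching_iff.1 heW
  apply heW₀
  rw [mem_edgesTouching_iff]
  refine ⟨hE, ?_⟩
  by_cases hx : x ∈ spacingIntVolume d b R'
  · exact ⟨x, hx, hxe⟩
  · have hx0 : x = 0 := mem_spacingVolume_sdiff_iff.1 (Finset.mem_sdiff.2 ⟨hxW, hx⟩)
    subst hx0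
    induction e using Sym2.ind with
    | _ u v =>
      have hadj : (zdGraph d).Adj u v := by simpa using hE
      rcases Sym2.mem_iff.1 hxe with h | h
      · subst h
        exact ⟨v, mem_spacingIntVolume_of_adj_zero hb hR' hadj, Sym2.mem_mk_right _ _⟩
      · subst h
        exact ⟨u, mem_spacingIntVolume_of_adj_zero hb hR' hadj.symm, Sym2.mem_mk_left _ _⟩

/-- The configuration `ζ` glued with the spin `τ₂` on the one-point set `W(R') ∖ Λ^int_{R'} = {0}`
is `ζ` updated at the origin. [cite: VanenterFernandezSokal1993, §4.1.2 Step 3] -/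
theorem glue_spacingVolume_sdiff_eq_update {b R' : ℕ} (ζ : SpinConfig (Site d))
    (τ₂ : ↥(spacingVolume d b R' \ spacingIntVolume d b R') → ℤˣ) :
    glue (spacingVolume d b R' \ spacingIntVolume d b R') τ₂ (.fixed ζ) =
      Function.update ζ 0 (τ₂ ⟨0, zero_mem_spacingVolume_sdiff b R'⟩) := by
  funext x
  by_cases hx : x ∈ spacingVolume d b R' \ spacingIntVolume d b R'
  · have hx0 : x = 0 := mem_spacingVolume_sdiff_iff.1 hx
    subst hx0
    rw [glue_apply_of_mem _ _ _ hx, Function.update_self]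
  · have hx0 : x ≠ 0 := fun h => hx (mem_spacingVolume_sdiff_iff.2 h)
    rw [glue_apply_of_notMem _ _ _ hx, BoundaryCondition.outside_fixed, Function.update_of_ne hx0]

/-- **Summing out the origin** (DLR in the volume, Friedli–Velenik Lemma 6.7, for the pair
`Λ^int_{R'} ⊆ W(R')`; §4.1.2 Step 3): for `b ≥ 2`, `R' ≥ 1`, any field `h` vanishing at the origin
and any `F`, the Boltzmann sum over `W(R')` with boundary condition `ζ` is the sum over the two
values `s = ±1` of the origin spin of the Boltzmann sums over `Λ^int_{R'}` with boundary condition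
`ζ[0 ↦ s]`. [cite: VanenterFernandezSokal1993, §4.1.2 Step 3, eqs. (4.7)–(4.9)] -/
theorem sum_fieldWeight_spacingVolume_eq {b R' : ℕ} (hb : 2 ≤ b) (hR' : 1 ≤ R')
    (ζ : SpinConfig (Site d)) (β : ℝ) {h : Site d → ℝ} (hh : h 0 = 0)
    (F : SpinConfig (Site d) → ℝ) :
    ∑ τ : ↥(spacingVolume d b R') → ℤˣ,
        fieldWeight (zdGraph d) (spacingVolume d b R') β h (.fixed ζ) τ *
          F (glue (spacingVolume d b R') τ (.fixed ζ)) =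
      ∑ s : ℤˣ, ∑ τ₁ : ↥(spacingIntVolume d b R') → ℤˣ,
        fieldWeight (zdGraph d) (spacingIntVolume d b R') β h (.fixed (Function.update ζ 0 s)) τ₁ *
          F (glue (spacingIntVolume d b R') τ₁ (.fixed (Function.update ζ 0 s))) := by
  have h0 : (0 : Site d) ∈ spacingVolume d b R' \ spacingIntVolume d b R' :=
    zero_mem_spacingVolume_sdiff b R'
  rw [sum_fieldWeight_fixed_eq_sum_sum (zdGraph d) (spacingIntVolume_subset b R') ζ β h F]
  -- the prefactor is `exp 0 = 1`
  have hpre : ∀ τ₂ : ↥(spacingVolume d b R' \ spacingIntVolume d b R') → ℤˣ,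
      Real.exp (β * (∑ e ∈ edgesTouching (zdGraph d) (spacingVolume d b R') \
            edgesTouching (zdGraph d) (spacingIntVolume d b R'),
          bondSpin (glue (spacingVolume d b R' \ spacingIntVolume d b R') τ₂ (.fixed ζ)) e +
        ∑ x ∈ spacingVolume d b R' \ spacingIntVolume d b R',
          h x * spinAt x (glue (spacingVolume d b R' \ spacingIntVolume d b R') τ₂ (.fixed ζ)))) =
        1 := by
    intro τ₂
    rw [edgesTouching_spacingVolume_sdiff_eq_empty hb hR', Finset.sum_empty, zero_add]
    have : ∑ x ∈ spacingVolume d b R' \ spacingIntVolume d b R',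
        h x * spinAt x (glue (spacingVolume d b R' \ spacingIntVolume d b R') τ₂ (.fixed ζ)) = 0 :=
      Finset.sum_eq_zero fun x hx => by rw [mem_spacingVolume_sdiff_iff.1 hx, hh, zero_mul]
    rw [this, mul_zero, Real.exp_zero]
  simp only [hpre, one_mul]
  -- reindex the spin on `{0}` by its value
  let e : (↥(spacingVolume d b R' \ spacingIntVolume d b R') → ℤˣ) ≃ ℤˣ :=
    { toFun := fun τ₂ => τ₂ ⟨0, h0⟩
      invFun := fun s _ => s
      left_inv := fun τ₂ => funext fun x => by
        have hx : x = ⟨0, h0⟩ := Subtype.ext (mem_spacingVolume_sdiff_iff.1 x.2)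
        rw [hx]
      right_inv := fun s => rfl }
  refine Fintype.sum_equiv e _ _ fun τ₂ => ?_
  rw [glue_spacingVolume_sdiff_eq_update ζ τ₂]
  rfl

/-- **The unfixing identity** (§4.1.2 Step 3, eqs. (4.7)–(4.9), for spacing `b`): for `b ≥ 2` and
`R' ≥ 1`, `⟨σ_0⟩^{ζ}_{ℤ^d;W(R');β,0} = (Z₊ - Z₋)/(Z₊ + Z₋)` where
`Z_s = Z^{ζ[0↦s]}_{ℤ^d;Λ^int_{R'};β,0}` are the zero-field partition functions of the internal
spins with the origin frozen to `s`. [cite: VanenterFernandezSokal1993, §4.1.2 Step 3, eqs. (4.7)–(4.9)] -/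
theorem isingExpect_spinAt_zero_spacingVolume_eq {b R' : ℕ} (hb : 2 ≤ b) (hR' : 1 ≤ R')
    (β : ℝ) (ζ : SpinConfig (Site d)) :
    isingExpect (zdGraph d) (spacingVolume d b R') β 0 (.fixed ζ) (spinAt 0) =
      (isingPartitionFunction (zdGraph d) (spacingIntVolume d b R') β 0
          (.fixed (Function.update ζ 0 1)) -
        isingPartitionFunction (zdGraph d) (spacingIntVolume d b R') β 0
          (.fixed (Function.update ζ 0 (-1)))) /
      (isingPartitionFunction (zdGraph d) (spacingIntVolume d b R') β 0
          (.fixed (Function.update ζ 0 1)) +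
        isingPartitionFunction (zdGraph d) (spacingIntVolume d b R') β 0
          (.fixed (Function.update ζ 0 (-1)))) := by
  have h0W₀ : (0 : Site d) ∉ spacingIntVolume d b R' := zero_notMem_spacingIntVolume b R'
  -- the value of `σ_0` under `ζ[0 ↦ s]` glued outside `Λ^int_{R'}`
  have hval : ∀ (s : ℤˣ) (τ₁ : ↥(spacingIntVolume d b R') → ℤˣ),
      spinAt 0 (glue (spacingIntVolume d b R') τ₁ (.fixed (Function.update ζ 0 s))) =
        ((s : ℤ) : ℝ) := fun s τ₁ => by
    rw [spinAt, glue_apply_of_notMem _ _ _ h0W₀, BoundaryCondition.outside_fixed,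
      Function.update_self]
  have hZ : ∀ s : ℤˣ, ∑ τ₁ : ↥(spacingIntVolume d b R') → ℤˣ,
      fieldWeight (zdGraph d) (spacingIntVolume d b R') β (fun _ => 0)
        (.fixed (Function.update ζ 0 s)) τ₁ =
        isingPartitionFunction (zdGraph d) (spacingIntVolume d b R') β 0
          (.fixed (Function.update ζ 0 s)) := fun s => by
    rw [← fieldZ_const]; rfl
  have hnum : ∀ s : ℤˣ, ∑ τ₁ : ↥(spacingIntVolume d b R') → ℤˣ,
      fieldWeight (zdGraph d) (spacingIntVolume d b R') β (fun _ => 0)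
          (.fixed (Function.update ζ 0 s)) τ₁ *
        spinAt 0 (glue (spacingIntVolume d b R') τ₁ (.fixed (Function.update ζ 0 s))) =
        ((s : ℤ) : ℝ) * isingPartitionFunction (zdGraph d) (spacingIntVolume d b R') β 0
          (.fixed (Function.update ζ 0 s)) := fun s => by
    rw [← hZ s, Finset.mul_sum]
    exact Finset.sum_congr rfl fun τ₁ _ => by rw [hval s τ₁, mul_comm]
  rw [← fieldExpect_const, fieldExpect_eq_sum_div _ _ _ _ _ (measurable_spinAt 0), fieldZ,
    sum_fieldWeight_spacingVolume_eq hb hR' ζ β rfl (spinAt 0)]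
  have hden := sum_fieldWeight_spacingVolume_eq hb hR' ζ β (h := fun _ => 0) rfl (fun _ => 1)
  simp only [mul_one] at hden
  rw [hden]
  simp only [hnum, hZ]
  rw [show (Finset.univ : Finset ℤˣ) = {1, -1} from rfl, Finset.sum_pair (units_ne_neg_self 1),
    Finset.sum_pair (units_ne_neg_self 1)]
  push_cast
  ring

/-! ### The partition functions `Z_s` in the `b`-diluted picture: bridge, locality and tilt -/

variable (d) in
/-- The R'-independent frozen configuration seen by the internal spins of the cube: the core
pattern `p·ω'_alt` on the image sites of `Λ_R`, the value `s` at the origin, `+1` everywhere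
else (§4.3.1 Step 2: the system `⟨R;∞;±;+⟩`, with the origin frozen to `s`).
[cite: VanenterFernandezSokal1993, §4.3.1 Step 2 and §4.1.2 Step 3] -/
def spCoreConfig (b : ℕ) (p : ℤˣ) (R : ℕ) (s : ℤˣ) : SpinConfig (Site d) :=
  Function.update (signedCoreAnnulusBC d b p R R 1 1) 0 s

/-- The quotient of an image site of the cube `box d (bR')` lies in `box d R'` (`b ≥ 1`).
[cite: VanenterFernandezSokal1993, §3.1.2 eq. (3.7)] -/
theorem ediv_mem_box_of_mem_box {b R' : ℕ} (hb : 0 < b) {a : Site d} (ha : IsSpImageSite d b a)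
    (hbox : a ∈ box d (b * R')) : (fun j => a j / b) ∈ box d R' := by
  rw [mem_box] at hbox ⊢
  intro j
  obtain ⟨m, hm⟩ := ha j
  have hb' : (0 : ℤ) < b := by exact_mod_cast hb
  have hq : a j / b = m := by rw [hm]; exact Int.mul_ediv_cancel_left _ hb'.ne'
  have hbR : ((b * R' : ℕ) : ℤ) = (b : ℤ) * R' := by push_cast; ring
  obtain ⟨h1, h2⟩ := hbox j
  rw [hbR, hm] at h1 h2
  rw [hq]
  constructor
  · have : (b : ℤ) * (-(R' : ℤ)) ≤ (b : ℤ) * m := by linarith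
    exact le_of_mul_le_mul_left this hb'
  · exact le_of_mul_le_mul_left h2 hb'

/-- On the image sites of the cube, `ζ_{R'} = ⟨R;R';p·ω'_alt;+;s_out⟩` updated at the origin and the
R'-independent `spCoreConfig` agree: both are `p·ω'_alt` on the core, `s` at the
origin and `+1` on the annulus. [cite: VanenterFernandezSokal1993, §4.3.1 Step 2] -/
theorem update_signedCoreAnnulusBC_eq_spCoreConfig {b : ℕ} (hb : 0 < b) (p : ℤˣ) (R : ℕ) {R' : ℕ}
    (s_out s : ℤˣ) {a : Site d} (ha : IsSpImageSite d b a)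
    (hbox : a ∈ box d (b * R')) :
    Function.update (signedCoreAnnulusBC d b p R R' 1 s_out) 0 s a = spCoreConfig d b p R s a := by
  classical
  unfold spCoreConfig
  by_cases ha0 : a = 0
  · subst ha0; simp
  · rw [Function.update_of_ne ha0, Function.update_of_ne ha0]
    have hq := ediv_mem_box_of_mem_box hb ha hbox
    rw [eq_mul_ediv_of_isSpImageSite ha, signedCoreAnnulusBC_apply_image hb,
      signedCoreAnnulusBC_apply_image hb]
    by_cases hR : (fun j => a j / b) ∈ box d R
    · rw [if_pos hR, if_pos hR]
    · rw [if_neg hR, if_pos hq, if_neg hR]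
      split_ifs <;> rfl

/-- Hence their fields agree on `Λ^int_{R'}` (`b ≥ 2`): image neighbours of internal
cube sites lie in the cube. [cite: VanenterFernandezSokal1993, §4.3.1 Step 2] -/
theorem imgField_update_signedCoreAnnulusBC_eq {b : ℕ} (hb : 2 ≤ b) (p : ℤˣ) (R : ℕ) {R' : ℕ}
    (s_out s : ℤˣ) {x : Site d} (hx : x ∈ spacingIntVolume d b R') :
    imgField d b (Function.update (signedCoreAnnulusBC d b p R R' 1 s_out) 0 s) x =
      imgField d b (spCoreConfig d b p R s) x := by
  refine Finset.sum_congr rfl fun a ha => ?_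
  rw [spinAt, spinAt, update_signedCoreAnnulusBC_eq_spCoreConfig (by omega) p R s_out s
    (mem_imgNbrs.1 ha).2 (mem_box_of_mem_imgNbrs hb (mem_box_of_mem_spacingIntVolume hx) ha)]

/-- On the outer boundary of `Λ^int_{R'}` in the `b`-diluted graph (internal sites outside the
cube), `ζ_{R'}[0 ↦ s]` takes the exterior value `s_out`. [cite: VanenterFernandezSokal1993, §4.3.1 Step 2] -/
theorem update_signedCoreAnnulusBC_apply_outerBoundary {b : ℕ} (p : ℤˣ) (R R' : ℕ) (s_out s : ℤˣ)
    {y : Site d} (hy : y ∈ outerBoundary (spDilutedGraph d b) (spacingIntVolume d b R')) :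
    Function.update (signedCoreAnnulusBC d b p R R' 1 s_out) 0 s y = (fun _ => s_out) y := by
  have hint : ¬ IsSpImageSite d b y := outerBoundary_spDilutedGraph_internal hy
  have hy0 : y ≠ 0 := fun h => hint (h ▸ isSpImageSite_zero b)
  rw [Function.update_of_ne hy0]
  exact signedCoreAnnulusBC_apply_internal p R R' 1 s_out hint

variable (d) in
/-- **The internal sites near the core**: internal sites with an image neighbour `a` whose image
index `a/b` lies in `Λ_R` (this includes the `2d` neighbours of the origin). Only there does the
field of `spCoreConfig` differ from the periodic all-`+` field.
[cite: VanenterFernandezSokal1993, §4.3.1 Step 2.2 ("finite-volume perturbation")] -/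
def spCoreSites (b R : ℕ) : Finset (Site d) :=
  (box d (b * R + 1)).filter fun k => ∃ a ∈ imgNbrs d b k, (fun j => a j / b) ∈ box d R

/-- Membership in `spCoreSites` (the cube constraint is automatic).
[cite: VanenterFernandezSokal1993, §4.3.1 Step 2.2] -/
theorem mem_spCoreSites_iff {b R : ℕ} (hb : 0 < b) {k : Site d} :
    k ∈ spCoreSites d b R ↔ ∃ a ∈ imgNbrs d b k, (fun j => a j / b) ∈ box d R := by
  rw [spCoreSites, Finset.mem_filter]
  refine ⟨fun h => h.2, fun h => ⟨?_, h⟩⟩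
  obtain ⟨a, ha, hbox⟩ := h
  obtain ⟨hadj, himg⟩ := mem_imgNbrs.1 ha
  have habox : a ∈ box d (b * R) := by
    rw [eq_mul_ediv_of_isSpImageSite himg, mem_box]
    intro j
    have hj := (mem_box.1 hbox) j
    have hb' : (0 : ℤ) ≤ b := by positivity
    push_cast
    constructor <;> nlinarith [hj.1, hj.2]
  exact mem_box_succ_of_adj habox hadj

/-- The neighbours of the origin are core sites (`b ≥ 2`). [cite: VanenterFernandezSokal1993, §4.1.2 Step 3] -/
theorem mem_spCoreSites_of_adj_zero {b : ℕ} (hb : 2 ≤ b) (R : ℕ) {y : Site d}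
    (hy : (zdGraph d).Adj 0 y) : y ∈ spCoreSites d b R :=
  (mem_spCoreSites_iff (by omega)).2 ⟨0, mem_imgNbrs.2 ⟨hy.symm, isSpImageSite_zero b⟩, by
    rw [mem_box]; intro j; simp⟩

/-- Core sites are internal (`b ≥ 2`). [cite: VanenterFernandezSokal1993, §4.3.1 Step 2.2] -/
theorem not_isSpImageSite_of_mem_spCoreSites {b : ℕ} (hb : 2 ≤ b) {R : ℕ} {k : Site d}
    (hk : k ∈ spCoreSites d b R) : ¬ IsSpImageSite d b k := by
  obtain ⟨a, ha, _⟩ := (mem_spCoreSites_iff (by omega)).1 hk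
  exact not_isSpImageSite_of_mem_imgNbrs hb ha

/-- Core sites have an image neighbour (they are field sites). [cite: VanenterFernandezSokal1993, §4.3.1 Step 2.2] -/
theorem imgNbrs_nonempty_of_mem_spCoreSites {b : ℕ} (hb : 0 < b) {R : ℕ} {k : Site d}
    (hk : k ∈ spCoreSites d b R) : (imgNbrs d b k).Nonempty := by
  obtain ⟨a, ha, _⟩ := (mem_spCoreSites_iff hb).1 hk
  exact ⟨a, ha⟩

/-- `spCoreSites d b R ⊆ Λ^int_{R'}` for `R' ≥ R + 1` (`b ≥ 2`). [cite: VanenterFernandezSokal1993, §4.3.1 Step 2.2] -/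
theorem spCoreSites_subset_spacingIntVolume {b : ℕ} (hb : 2 ≤ b) {R R' : ℕ} (hRR' : R + 1 ≤ R') :
    spCoreSites d b R ⊆ spacingIntVolume d b R' := fun k hk => by
  have hbox : k ∈ box d (b * R + 1) := (Finset.mem_filter.1 hk).1
  refine Finset.mem_filter.2 ⟨box_mono d ?_ hbox, not_isSpImageSite_of_mem_spCoreSites hb hk⟩
  nlinarith

/-- Off the core sites the field of `spCoreConfig` is the periodic all-`+` field: every image
neighbour `a` of such a site has `a ≠ 0` and `a/b ∉ Λ_R`, where `spCoreConfig = +1`.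
[cite: VanenterFernandezSokal1993, §4.3.1 Step 2.2 ("finite-volume perturbation")] -/
theorem imgField_spCoreConfig_eq_of_notMem {b : ℕ} (hb : 0 < b) (p : ℤˣ) {R : ℕ} (s : ℤˣ)
    {x : Site d} (hx : x ∉ spCoreSites d b R) :
    imgField d b (spCoreConfig d b p R s) x = imgField d b 1 x := by
  classical
  refine Finset.sum_congr rfl fun a ha => ?_
  have himg := (mem_imgNbrs.1 ha).2
  have hR : (fun j => a j / b) ∉ box d R := fun h => hx ((mem_spCoreSites_iff hb).2 ⟨a, ha, h⟩)
  have ha0 : a ≠ 0 := by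
    rintro rfl
    apply hR
    rw [mem_box]; intro j; simp
  rw [spinAt, spinAt, spCoreConfig, Function.update_of_ne ha0, eq_mul_ediv_of_isSpImageSite himg,
    signedCoreAnnulusBC_apply_image hb, if_neg hR]
  split_ifs <;> rfl


/-! ### The periodic all-`+` image system `⟨∞;+⟩`: period-`b` translations, its field, the tiling -/

variable (d) in
/-- Translation by the period vector `b z`. [cite: VanenterFernandezSokal1993, §4.3.1 Step 2.2 ("an Ising model on a periodic lattice")] -/
def spShift (b : ℕ) (z : Site d) : Site d ≃ Site d := Site.shift ((b : ℤ) • z)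

/-- `spShift d b z x = x + b z`. [folklore] -/
@[simp] theorem spShift_apply (b : ℕ) (z x : Site d) : spShift d b z x = x + (b : ℤ) • z := rfl

/-- `(spShift d b z)⁻¹ x = x - b z`. [folklore] -/
theorem spShift_symm_apply (b : ℕ) (z x : Site d) : (spShift d b z).symm x = x - (b : ℤ) • z := by
  rw [spShift, Site.shift_symm_apply]

/-- Period-`b` translations are automorphisms of the `b`-diluted graph.
[cite: VanenterFernandezSokal1993, §4.3.1 Step 2.2] -/
theorem spDilutedGraph_adj_spShift (b : ℕ) (z x y : Site d) :
    (spDilutedGraph d b).Adj (spShift d b z x) (spShift d b z y) ↔ (spDilutedGraph d b).Adj x y := by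
  simp only [spDilutedGraph_adj, spShift]
  rw [zdGraph_adj_shift_iff, Site.shift_apply, Site.shift_apply, isSpImageSite_add_smul,
    isSpImageSite_add_smul]

/-- The image neighbours are translated along. [cite: VanenterFernandezSokal1993, §4.3.1 Step 2.2] -/
theorem mem_imgNbrs_add_smul {b : ℕ} {z k a : Site d} :
    a ∈ imgNbrs d b (k + (b : ℤ) • z) ↔ a - (b : ℤ) • z ∈ imgNbrs d b k := by
  rw [mem_imgNbrs, mem_imgNbrs, ← isSpImageSite_add_smul (a - (b : ℤ) • z) z, sub_add_cancel,
    ← zdGraph_adj_shift_iff ((b : ℤ) • z) k (a - (b : ℤ) • z), Site.shift_apply,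
    Site.shift_apply, sub_add_cancel]

/-- `imgNbrs (x + b z) = imgNbrs x + b z`. [cite: VanenterFernandezSokal1993, §4.3.1 Step 2.2] -/
theorem imgNbrs_spShift (b : ℕ) (z k : Site d) :
    imgNbrs d b (spShift d b z k) = (imgNbrs d b k).map (spShift d b z).toEmbedding := by
  ext a
  rw [Finset.mem_map_equiv, spShift_symm_apply, spShift_apply, mem_imgNbrs_add_smul]

/-- **The periodic field of `⟨∞;+⟩`** (all image spins `+`): `h⁺_k = #(image neighbours of k)`
(§4.3.2: "a periodic … magnetic field which is nonzero at the sites neighboring an image spin";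
for `b = 2` this is `2` at the sites with one odd coordinate, for `b ≥ 3` it is `1` at the sites
`bx ± eᵢ`). [cite: VanenterFernandezSokal1993, §4.3.1 Step 2.2 and §4.3.2] -/
theorem imgField_one_eq_card (b : ℕ) (k : Site d) :
    imgField d b 1 k = ((imgNbrs d b k).card : ℝ) := by
  unfold imgField
  have : ∀ a ∈ imgNbrs d b k, spinAt a (1 : SpinConfig (Site d)) = 1 := fun a _ => by simp [spinAt]
  rw [Finset.sum_congr rfl this, Finset.sum_const, nsmul_eq_mul, mul_one]

/-- The periodic field is nonnegative. [cite: VanenterFernandezSokal1993, §4.3.1 Step 2.2] -/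
theorem imgField_one_nonneg (b : ℕ) (k : Site d) : 0 ≤ imgField d b 1 k := by
  rw [imgField_one_eq_card]; positivity

/-- The periodic field is positive exactly at the field sites. [cite: VanenterFernandezSokal1993, §4.3.1 Step 2.2] -/
theorem imgField_one_pos {b : ℕ} {k : Site d} (hk : (imgNbrs d b k).Nonempty) :
    0 < imgField d b 1 k := by
  rw [imgField_one_eq_card]; exact_mod_cast hk.card_pos

/-- The periodic field is invariant under the period-`b` translations.
[cite: VanenterFernandezSokal1993, §4.3.1 Step 2.2] -/
theorem imgField_one_spShift (b : ℕ) (z x : Site d) :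
    imgField d b 1 (spShift d b z x) = imgField d b 1 x := by
  rw [imgField_one_eq_card, imgField_one_eq_card, imgNbrs_spShift, Finset.card_map]

variable (d) in
/-- The cube `[-bn, bn + b - 1]^d`, tiled by the translates `{0,…,b-1}^d + bz`, `z ∈ box d n`.
[cite: FriedliVelenik2017, §3.2.1] -/
def spTiledCube (b n : ℕ) : Finset (Site d) :=
  (box d n).biUnion fun z => (halfOpenBox d b).map (spShift d b z).toEmbedding

/-- The translates of the cell `{0,…,b-1}^d` by distinct period vectors are disjoint (`b ≥ 1`).
[cite: FriedliVelenik2017, §3.2.1] -/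
theorem pairwiseDisjoint_spShift_halfOpenBox {b : ℕ} (hb : 0 < b) (S : Finset (Site d)) :
    (↑S : Set (Site d)).PairwiseDisjoint
      fun z => (halfOpenBox d b).map (spShift d b z).toEmbedding := by
  have hb' : (0 : ℤ) < b := by exact_mod_cast hb
  intro z _ z' _ hne
  rw [Function.onFun, Finset.disjoint_left]
  intro x hx hx'
  rw [Finset.mem_map_equiv, mem_halfOpenBox] at hx hx'
  apply hne
  funext i
  have h1 := hx i
  have h2 := hx' i
  simp only [spShift_symm_apply, Pi.sub_apply, Pi.smul_apply, smul_eq_mul] at h1 h2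
  have e1 : x i / b = z i :=
    ((Int.ediv_emod_unique hb').2 ⟨by ring, h1.1, h1.2⟩).1
  have e2 : x i / b = z' i :=
    ((Int.ediv_emod_unique hb').2 ⟨by ring, h2.1, h2.2⟩).1
  rw [← e1, ← e2]

/-- `box d (bn) ⊆ spTiledCube d b n` (`b ≥ 1`). [cite: FriedliVelenik2017, §3.2.1] -/
theorem box_subset_spTiledCube {b : ℕ} (hb : 0 < b) (n : ℕ) : box d (b * n) ⊆ spTiledCube d b n := by
  have hb' : (0 : ℤ) < b := by exact_mod_cast hb
  intro x hx
  rw [mem_box] at hx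
  rw [spTiledCube, Finset.mem_biUnion]
  refine ⟨fun i => x i / b, ?_, ?_⟩
  · rw [mem_box]
    intro i
    obtain ⟨h1, h2⟩ := hx i
    push_cast at h1 h2
    exact ⟨Int.le_ediv_of_mul_le hb' (by linarith), Int.ediv_le_of_le_mul hb' (by linarith)⟩
  · rw [Finset.mem_map_equiv, mem_halfOpenBox]
    intro i
    simp only [spShift_symm_apply, Pi.sub_apply, Pi.smul_apply, smul_eq_mul]
    rw [← Int.emod_def]
    exact ⟨Int.emod_nonneg _ hb'.ne', Int.emod_lt_of_pos _ hb'⟩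

/-- `spTiledCube d b n ⊆ box d (bn + b)`. [cite: FriedliVelenik2017, §3.2.1] -/
theorem spTiledCube_subset_box (b n : ℕ) : spTiledCube d b n ⊆ box d (b * n + b) := by
  intro x hx
  rw [spTiledCube, Finset.mem_biUnion] at hx
  obtain ⟨z, hz, hx⟩ := hx
  rw [Finset.mem_map_equiv, mem_halfOpenBox] at hx
  rw [mem_box] at hz ⊢
  intro i
  have h1 := hx i
  obtain ⟨hz1, hz2⟩ := hz i
  simp only [spShift_symm_apply, Pi.sub_apply, Pi.smul_apply, smul_eq_mul] at h1
  have hb0 : (0 : ℤ) ≤ b := by positivity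
  have hlo : (b : ℤ) * (-(n : ℤ)) ≤ (b : ℤ) * z i := mul_le_mul_of_nonneg_left hz1 hb0
  have hhi : (b : ℤ) * z i ≤ (b : ℤ) * n := mul_le_mul_of_nonneg_left hz2 hb0
  push_cast
  constructor <;> linarith [h1.1, h1.2]

/-- The outer boundary of the tiled cube lies in the shell `box d (bn+b+1) ∖ box d (bn)`.
[cite: FriedliVelenik2017, §3.2.1 Exercise 3.1] -/
theorem outerBoundary_spTiledCube_subset {b : ℕ} (hb : 0 < b) (n : ℕ) :
    outerBoundary (zdGraph d) (spTiledCube d b n) ⊆ box d (b * n + b + 1) \ box d (b * n) := by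
  intro y hy
  rw [mem_outerBoundary_iff] at hy
  obtain ⟨hyT, x, hx, hadj⟩ := hy
  exact Finset.mem_sdiff.2 ⟨mem_box_succ_of_adj (spTiledCube_subset_box b n hx) hadj,
    fun hyb => hyT (box_subset_spTiledCube hb n hyb)⟩

/-- **The tiled cubes are van Hove relative to the number of tiles**:
`|∂ᵉ_{𝔻_b} spTiledCube d b n| / |box d n| → 0`. [cite: FriedliVelenik2017, §3.2.1 Exercise 3.1] -/
theorem tendsto_card_edgeBoundary_spTiledCube_div {b : ℕ} (hb : 0 < b) :
    Tendsto (fun n => ((edgeBoundary (spDilutedGraph d b) (spTiledCube d b n)).card : ℝ) /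
      (box d n).card) atTop (𝓝 0) := by
  -- the bound `2d((2bn+2b+3)^d - (2bn+1)^d) / (2n+1)^d`
  have hbound : ∀ n : ℕ,
      ((edgeBoundary (spDilutedGraph d b) (spTiledCube d b n)).card : ℝ) / (box d n).card ≤
        2 * d * (((2 * b * (n : ℝ) + (2 * b + 3)) / (2 * n + 1)) ^ d -
          ((2 * b * (n : ℝ) + 1) / (2 * n + 1)) ^ d) := by
    intro n
    have h1 : (edgeBoundary (spDilutedGraph d b) (spTiledCube d b n)).card ≤
        2 * d * (box d (b * n + b + 1) \ box d (b * n)).card :=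
      (Finset.card_le_card (edgeBoundary_mono_graph (spDilutedGraph_le b) _)).trans
        ((card_edgeBoundary_le (spTiledCube d b n)).trans
          (Nat.mul_le_mul_left _ (Finset.card_le_card (outerBoundary_spTiledCube_subset hb n))))
    rw [Finset.card_sdiff_of_subset (box_mono d (by omega)), card_box, card_box] at h1
    have hle : (2 * (b * n) + 1) ^ d ≤ (2 * (b * n + b + 1) + 1) ^ d :=
      Nat.pow_le_pow_left (by omega) d
    have hcast : ((edgeBoundary (spDilutedGraph d b) (spTiledCube d b n)).card : ℝ) ≤
        2 * d * ((2 * b * (n : ℝ) + (2 * b + 3)) ^ d - (2 * b * (n : ℝ) + 1) ^ d) := by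
      have := (Nat.cast_le (α := ℝ)).2 h1
      push_cast [Nat.cast_sub hle] at this
      have e1 : (2 * ((b : ℝ) * n + b + 1) + 1) = 2 * b * (n : ℝ) + (2 * b + 3) := by ring
      have e2 : (2 * ((b : ℝ) * n) + 1) = 2 * b * (n : ℝ) + 1 := by ring
      rw [e1, e2] at this
      exact this
    have key : (2 : ℝ) * d * (((2 * b * (n : ℝ) + (2 * b + 3)) / (2 * n + 1)) ^ d -
        ((2 * b * (n : ℝ) + 1) / (2 * n + 1)) ^ d) =
        2 * d * ((2 * b * (n : ℝ) + (2 * b + 3)) ^ d - (2 * b * (n : ℝ) + 1) ^ d) /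
          (2 * (n : ℝ) + 1) ^ d := by
      rw [div_pow, div_pow, ← sub_div, mul_div_assoc]
    rw [key, card_box]
    push_cast
    rw [div_le_div_iff_of_pos_right (by positivity)]
    exact hcast
  -- the bound tends to `2d(b^d - b^d) = 0`
  have h0 : Tendsto (fun n : ℕ => 2 * (n : ℝ) + 1) atTop atTop :=
    tendsto_atTop_mono (fun n => by linarith [(Nat.cast_nonneg n : (0 : ℝ) ≤ n)])
      tendsto_natCast_atTop_atTop
  have hq : ∀ c : ℝ, Tendsto (fun n : ℕ => (2 * b * (n : ℝ) + c) / (2 * n + 1)) atTop (𝓝 b) := by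
    intro c
    have h1 : Tendsto (fun n : ℕ => (c - b) / (2 * (n : ℝ) + 1)) atTop (𝓝 0) :=
      tendsto_const_nhds.div_atTop h0
    have : Tendsto (fun n : ℕ => (b : ℝ) + (c - b) / (2 * (n : ℝ) + 1)) atTop (𝓝 b) := by
      simpa using (tendsto_const_nhds (x := (b : ℝ))).add h1
    refine this.congr' (Eventually.of_forall fun n => ?_)
    have hpos : (0 : ℝ) < 2 * (n : ℝ) + 1 := by positivity
    field_simp
    ring
  have hlim : Tendsto (fun n : ℕ => 2 * (d : ℝ) * (((2 * b * (n : ℝ) + (2 * b + 3)) / (2 * n + 1)) ^ d -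
      ((2 * b * (n : ℝ) + 1) / (2 * n + 1)) ^ d)) atTop (𝓝 0) := by
    have := (((hq (2 * b + 3)).pow d).sub ((hq 1).pow d)).const_mul (2 * (d : ℝ))
    simpa using this
  exact squeeze_zero (fun n => div_nonneg (Nat.cast_nonneg _) (Nat.cast_nonneg _)) hbound hlim

/-! ### Uniqueness at the field sites of `⟨∞;+⟩` (Step 2.2) along the volumes `Λ^int_{R'}` -/

/-- **Uniqueness at the field sites of the periodic internal-spin system `⟨∞;+⟩` for spacing `b`**
(van Enter–Fernández–Sokal §4.3.1 Step 2.2, "The system has a unique Gibbs measure … it is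
enough to prove uniqueness … when all the image spins … are set in the '+' position"; here at the
sites carrying the field, by GHS and convexity — `exists_volume_plusMag_sub_minusMag_le` — rather
than Lee–Yang): for `β > 0`, a field site `k` and `ε > 0` there is a finite `Λ₀` with
`⟨σ_k⟩⁺_{𝔻_b;Λ;h⁺} - ⟨σ_k⟩⁻_{𝔻_b;Λ;h⁺} ≤ ε` for all `Λ ⊇ Λ₀`.
[cite: VanenterFernandezSokal1993, §4.3.1 Step 2.2 and §4.3.2] -/
theorem exists_volume_plusMag_sub_minusMag_le_spDiluted {b : ℕ} (hb : 0 < b) {β : ℝ} (hβ : 0 < β)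
    {k : Site d} (hk : (imgNbrs d b k).Nonempty) {ε : ℝ} (hε : 0 < ε) :
    ∃ Λ₀ : Finset (Site d), ∀ Λ' : Finset (Site d), Λ₀ ⊆ Λ' →
      plusMag (spDilutedGraph d b) β (imgField d b 1) Λ' k 1 -
        minusMag (spDilutedGraph d b) β (imgField d b 1) Λ' k 1 ≤ ε := by
  have hb' : (0 : ℤ) < b := by exact_mod_cast hb
  -- `k = c + bz` with `c` in the cell
  set z : Site d := fun i => k i / b with hz
  set c : Site d := fun i => k i % b with hc
  have hkc : k = spShift d b z c := by
    funext i
    simp only [spShift_apply, Pi.add_apply, Pi.smul_apply, smul_eq_mul, hz, hc]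
    rw [Int.emod_def]; ring
  have hcmem : c ∈ halfOpenBox d b := by
    rw [mem_halfOpenBox]
    intro i
    exact ⟨Int.emod_nonneg _ hb'.ne', Int.emod_lt_of_pos _ hb'⟩
  have hvc : 0 < imgField d b 1 c := by
    have : imgField d b 1 c = imgField d b 1 k := by rw [hkc, imgField_one_spShift]
    rw [this]
    exact imgField_one_pos hk
  obtain ⟨Λ₀, hΛ₀⟩ := exists_volume_plusMag_sub_minusMag_le (G := spDilutedGraph d b)
    (v := imgField d b 1) hβ (imgField_one_nonneg b) one_pos (spShift d b)
    (fun z x y => spDilutedGraph_adj_spShift b z x y) (fun z x => imgField_one_spShift b z x)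
    (halfOpenBox d b) (box d) (spTiledCube d b) (fun _ => rfl)
    (fun n => pairwiseDisjoint_spShift_halfOpenBox hb (box d n)) (box_nonempty d)
    (tendsto_card_edgeBoundary_spTiledCube_div hb) hcmem hvc hε
  refine ⟨Λ₀.map (spShift d b z).toEmbedding, ?_⟩
  rw [hkc]
  exact forall_volume_plusMag_sub_minusMag_le_equiv (spDilutedGraph d b) (spShift d b z)
    (spDilutedGraph_adj_spShift b z) (imgField_one_spShift b z) hΛ₀

/-- **Uniqueness along the volumes `Λ^int_{R'}`** (Steps 2.1–2.2): for `b ≥ 2`, `β > 0` and a field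
site `k`, `⟨σ_k⟩⁺_{𝔻_b;Λ^int_{R'};h⁺} - ⟨σ_k⟩⁻_{𝔻_b;Λ^int_{R'};h⁺} → 0` as `R' → ∞` (the image sites
of `Λ₀` are isolated in `𝔻_b` and may be discarded). [cite: VanenterFernandezSokal1993, §4.3.1 Steps 2.1–2.2] -/
theorem tendsto_plusMag_sub_minusMag_spacingIntVolume {b : ℕ} (hb : 2 ≤ b) {β : ℝ} (hβ : 0 < β)
    {k : Site d} (hk : (imgNbrs d b k).Nonempty) :
    Tendsto (fun R' => plusMag (spDilutedGraph d b) β (imgField d b 1) (spacingIntVolume d b R') k 1 -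
      minusMag (spDilutedGraph d b) β (imgField d b 1) (spacingIntVolume d b R') k 1) atTop (𝓝 0) := by
  classical
  have hb0 : 0 < b := by omega
  rw [Metric.tendsto_atTop]
  intro ε hε
  obtain ⟨Λ₀, hΛ₀⟩ := exists_volume_plusMag_sub_minusMag_le_spDiluted hb0 hβ hk (half_pos hε)
  have hkint : ¬ IsSpImageSite d b k := by
    obtain ⟨a, ha⟩ := hk
    exact not_isSpImageSite_of_mem_imgNbrs hb ha
  set S : Finset (Site d) := insert k (Λ₀.filter fun x => ¬ IsSpImageSite d b x) with hS
  have hSint : ∀ x ∈ S, ¬ IsSpImageSite d b x := fun x hx => by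
    rcases Finset.mem_insert.1 hx with rfl | hx
    · exact hkint
    · exact (Finset.mem_filter.1 hx).2
  obtain ⟨N, hN⟩ := eventually_atTop.1 (eventually_subset_spacingIntVolume (by omega) S hSint)
  refine ⟨N, fun R' hR' => ?_⟩
  have hSsub := hN R' hR'
  have hkW : k ∈ spacingIntVolume d b R' := hSsub (Finset.mem_insert_self _ _)
  -- the enlarged volume `Λ' = Λ^int_{R'} ∪ (image sites of Λ₀)` contains `Λ₀`
  set D : Finset (Site d) := Λ₀.filter fun x => IsSpImageSite d b x with hD
  set Λ' : Finset (Site d) := spacingIntVolume d b R' ∪ D with hΛ'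
  have hΛ₀Λ' : Λ₀ ⊆ Λ' := fun x hx => by
    by_cases hdx : IsSpImageSite d b x
    · exact Finset.mem_union_right _ (Finset.mem_filter.2 ⟨hx, hdx⟩)
    · exact Finset.mem_union_left _
        (hSsub (Finset.mem_insert_of_mem (Finset.mem_filter.2 ⟨hx, hdx⟩)))
  have hsub : spacingIntVolume d b R' ⊆ Λ' := Finset.subset_union_left
  have hdisj : ∀ x ∈ Λ' \ spacingIntVolume d b R',
      x ∉ outerBoundary (spDilutedGraph d b) (spacingIntVolume d b R') := by
    intro x hx hxb
    obtain ⟨hxΛ', hxW⟩ := Finset.mem_sdiff.1 hx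
    rcases Finset.mem_union.1 hxΛ' with h | h
    · exact hxW h
    · exact outerBoundary_spDilutedGraph_internal hxb (Finset.mem_filter.1 h).2
  have hloc : ∀ σ σ' : SpinConfig (Site d), (∀ x ∈ spacingIntVolume d b R', σ x = σ' x) →
      spinAt k σ = spinAt k σ' := fun σ σ' h => by simp only [spinAt, h k hkW]
  have hp : plusMag (spDilutedGraph d b) β (imgField d b 1) Λ' k 1 =
      plusMag (spDilutedGraph d b) β (imgField d b 1) (spacingIntVolume d b R') k 1 :=
    fieldExpect_fixed_eq_of_sdiff_isolated (spDilutedGraph d b) hsub hdisj 1 β _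
      (measurable_spinAt k) hloc
  have hm : minusMag (spDilutedGraph d b) β (imgField d b 1) Λ' k 1 =
      minusMag (spDilutedGraph d b) β (imgField d b 1) (spacingIntVolume d b R') k 1 :=
    fieldExpect_fixed_eq_of_sdiff_isolated (spDilutedGraph d b) hsub hdisj (-1) β _
      (measurable_spinAt k) hloc
  have hle := hΛ₀ Λ' hΛ₀Λ'
  rw [hp, hm] at hle
  have hnn : 0 ≤ plusMag (spDilutedGraph d b) β (imgField d b 1) (spacingIntVolume d b R') k 1 -
      minusMag (spDilutedGraph d b) β (imgField d b 1) (spacingIntVolume d b R') k 1 :=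
    sub_nonneg.2 (minusMag_le_plusMag hβ.le _ _ k 1)
  rw [Real.dist_eq, sub_zero, abs_of_nonneg hnn]
  linarith

/-- The field `1 • h⁺` of `plusMag`/`minusMag` is the periodic field `h⁺`. [folklore] -/
theorem affCpl_zero_imgField_one (b : ℕ) : affCpl 0 (imgField d b 1) 1 = imgField d b 1 := by
  funext k; simp [affCpl]

/-- **Insensitivity to the `±` boundary condition in the periodic field `h⁺`** of every observable
of the spins in the core sites, along the volumes `Λ^int_{R'}` (the finite-volume form of "the
system `⟨R;∞;±;+⟩` has a unique Gibbs measure" used here).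
[cite: VanenterFernandezSokal1993, §4.3.1 Steps 2.1–2.2 and §4.3.2] -/
theorem tendsto_per_plus_sub_minus_spacing {b : ℕ} (hb : 2 ≤ b) {β : ℝ} (hβ : 0 < β) (R : ℕ)
    {f : SpinConfig (Site d) → ℝ} (hfm : Measurable f)
    (hloc : ∀ σ σ' : SpinConfig (Site d), (∀ k ∈ spCoreSites d b R, σ k = σ' k) → f σ = f σ') :
    Tendsto (fun R' =>
      fieldExpect (spDilutedGraph d b) (spacingIntVolume d b R') β (imgField d b 1) .plus f -
        fieldExpect (spDilutedGraph d b) (spacingIntVolume d b R') β (imgField d b 1) .minus f)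
      atTop (𝓝 0) := by
  refine tendsto_fieldExpect_plus_sub_minus_of_local (spDilutedGraph d b) hβ.le _
    (spacingIntVolume d b) (spCoreSites d b R) hfm hloc fun k hk => ?_
  have := tendsto_plusMag_sub_minusMag_spacingIntVolume hb hβ
    (imgNbrs_nonempty_of_mem_spCoreSites (by omega) hk)
  simpa only [plusMag, minusMag, affCpl_zero_imgField_one] using this


/-! ### The partition functions `Z_s` as tilted expectations in the periodic system `⟨∞;+⟩` -/

/-- The partition function depends on the field only through its values on the volume.
[cite: FriedliVelenik2017, §3.1 eq. (3.2)] -/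
theorem fieldZ_congr_field {W : Type*} (G' : SimpleGraph W) [DecidableEq W] [G'.LocallyFinite]
    {Λ : Finset W} (β : ℝ) {h₁ h₂ : W → ℝ} (hh : ∀ x ∈ Λ, h₁ x = h₂ x) (bc : BoundaryCondition W) :
    fieldZ G' Λ β h₁ bc = fieldZ G' Λ β h₂ bc := by
  unfold fieldZ fieldWeight
  refine Finset.sum_congr rfl fun τ _ => ?_
  rw [fieldHamiltonian_congr G' hh]

variable (d) in
/-- **The tilt from the periodic all-`+` field to the field of `⟨R;∞;p·ω'_alt;+⟩` with the origin
frozen to `s`**: `T_s(σ) = exp(β ∑_{x ∈ spCoreSites} (h^{η_s}_x - h⁺_x) σ_x)`, `η_s = spCoreConfig`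
("changing the image spins inside `Λ_R` amounts to a finite-volume perturbation of the system … if
`W` is the perturbation, then `μ'(·) = μ(· e^{-W})/μ(e^{-W})`", Step 2.2).
[cite: VanenterFernandezSokal1993, §4.3.1 Step 2.2] -/
def spCoreTilt (b : ℕ) (p : ℤˣ) (R : ℕ) (β : ℝ) (s : ℤˣ) (σ : SpinConfig (Site d)) : ℝ :=
  Real.exp (β * ∑ x ∈ spCoreSites d b R,
    (imgField d b (spCoreConfig d b p R s) x - imgField d b 1 x) * spinAt x σ)

/-- Measurability of the tilt. [folklore] -/
theorem measurable_spCoreTilt (b : ℕ) (p : ℤˣ) (R : ℕ) (β : ℝ) (s : ℤˣ) :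
    Measurable (spCoreTilt d b p R β s) :=
  Real.measurable_exp.comp
    ((Finset.measurable_sum _ fun x _ => (measurable_spinAt x).const_mul _).const_mul _)

/-- The tilt depends only on the spins of the core sites. [folklore] -/
theorem spCoreTilt_local (b : ℕ) (p : ℤˣ) (R : ℕ) (β : ℝ) (s : ℤˣ) (σ σ' : SpinConfig (Site d))
    (h : ∀ k ∈ spCoreSites d b R, σ k = σ' k) :
    spCoreTilt d b p R β s σ = spCoreTilt d b p R β s σ' := by
  unfold spCoreTilt
  rw [Finset.sum_congr rfl fun k hk =>
    show (imgField d b (spCoreConfig d b p R s) k - imgField d b 1 k) * spinAt k σ =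
      (imgField d b (spCoreConfig d b p R s) k - imgField d b 1 k) * spinAt k σ' by
      simp only [spinAt, h k hk]]

/-- `|h^η_x - h⁺_x| ≤ 2 #(imgNbrs x)` for every frozen configuration `η`. [folklore] -/
theorem abs_imgField_sub_imgField_one_le (b : ℕ) (η : SpinConfig (Site d)) (x : Site d) :
    |imgField d b η x - imgField d b 1 x| ≤ 2 * (imgNbrs d b x).card := by
  unfold imgField
  rw [← Finset.sum_sub_distrib]
  refine (Finset.abs_sum_le_sum_abs _ _).trans ?_
  have h2 : ∀ a ∈ imgNbrs d b x, |spinAt a η - spinAt a (1 : SpinConfig (Site d))| ≤ 2 := by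
    intro a _
    have h1 : spinAt a (1 : SpinConfig (Site d)) = 1 := by simp [spinAt]
    rw [h1]
    rcases spinAt_eq_one_or_eq_neg_one a η with h | h <;> rw [h] <;> norm_num
  refine (Finset.sum_le_sum h2).trans ?_
  rw [Finset.sum_const, nsmul_eq_mul, mul_comm]

variable (d) in
/-- The uniform exponent bound of the tilt: `C = 2 ∑_{x ∈ spCoreSites} #(imgNbrs x)`. [folklore] -/
def spCoreTiltExp (b R : ℕ) : ℝ := 2 * ∑ x ∈ spCoreSites d b R, ((imgNbrs d b x).card : ℝ)

/-- Two-sided bounds on the tilt for `β ≥ 0`: `e^{-βC} ≤ T_s ≤ e^{βC}`. [folklore] -/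
theorem spCoreTilt_mem_Icc (b : ℕ) (p : ℤˣ) (R : ℕ) {β : ℝ} (hβ : 0 ≤ β) (s : ℤˣ)
    (σ : SpinConfig (Site d)) :
    spCoreTilt d b p R β s σ ∈ Set.Icc (Real.exp (-(β * spCoreTiltExp d b R)))
      (Real.exp (β * spCoreTiltExp d b R)) := by
  have hsum : |∑ x ∈ spCoreSites d b R,
      (imgField d b (spCoreConfig d b p R s) x - imgField d b 1 x) * spinAt x σ| ≤
        spCoreTiltExp d b R := by
    refine (Finset.abs_sum_le_sum_abs _ _).trans ?_
    rw [spCoreTiltExp, Finset.mul_sum]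
    refine Finset.sum_le_sum fun x _ => ?_
    rw [abs_mul, abs_spinAt, mul_one]
    exact abs_imgField_sub_imgField_one_le b _ x
  obtain ⟨h1, h2⟩ := abs_le.1 hsum
  constructor <;> apply Real.exp_le_exp.2 <;> nlinarith

/-- **The partition function `Z_s` with the origin frozen to `s` as a tilted expectation in the
periodic system** (bridge, field congruence, locality of the boundary condition and the field
tilt): for `b ≥ 2` and `R' ≥ R + 1`,
`Z^{ζ_{R'}[0↦s]}_{ℤ^d;Λ^int_{R'};β,0} = Z^{s_out}_{𝔻_b;Λ^int_{R'};β,h⁺} · ⟨T_s⟩^{s_out}_{𝔻_b;Λ^int_{R'};β,h⁺}`,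
where `ζ_{R'} = ⟨R;R';p·ω'_alt;+;s_out⟩` and `h⁺` is the periodic all-`+` field ("changing the image
spins inside `Λ_R` amounts to a finite-volume perturbation of the system", Step 2.2).
[cite: VanenterFernandezSokal1993, §4.3.1 Step 2.2] -/
theorem isingPartitionFunction_update_eq_fieldZ_mul {b : ℕ} (hb : 2 ≤ b) (p : ℤˣ) {R R' : ℕ}
    (hRR' : R + 1 ≤ R') (β : ℝ) (s_out s : ℤˣ) :
    isingPartitionFunction (zdGraph d) (spacingIntVolume d b R') β 0
        (.fixed (Function.update (signedCoreAnnulusBC d b p R R' 1 s_out) 0 s)) =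
      fieldZ (spDilutedGraph d b) (spacingIntVolume d b R') β (imgField d b 1)
          (.fixed fun _ => s_out) *
        fieldExpect (spDilutedGraph d b) (spacingIntVolume d b R') β (imgField d b 1)
          (.fixed fun _ => s_out) (spCoreTilt d b p R β s) := by
  have hint : ∀ x ∈ spacingIntVolume d b R', ¬ IsSpImageSite d b x := fun x hx =>
    not_isSpImageSite_of_mem_spacingIntVolume hx
  -- (1) the bridge
  have h1 := isingPartitionFunction_zd_eq_fieldZ_spDiluted hint β
    (Function.update (signedCoreAnnulusBC d b p R R' 1 s_out) 0 s)
  -- (2) field congruence on the volume: the field of `ζ_{R'}[0↦s]` is that of `spCoreConfig`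
  have h2 : fieldZ (spDilutedGraph d b) (spacingIntVolume d b R') β
      (imgField d b (Function.update (signedCoreAnnulusBC d b p R R' 1 s_out) 0 s))
      (.fixed (Function.update (signedCoreAnnulusBC d b p R R' 1 s_out) 0 s)) =
      fieldZ (spDilutedGraph d b) (spacingIntVolume d b R') β (imgField d b (spCoreConfig d b p R s))
      (.fixed (Function.update (signedCoreAnnulusBC d b p R R' 1 s_out) 0 s)) :=
    fieldZ_congr_field (spDilutedGraph d b) β
      (fun x hx => imgField_update_signedCoreAnnulusBC_eq hb p R s_out s hx) _
  -- (3) locality of the boundary condition: `ζ_{R'}[0↦s] = s_out` on the outer boundary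
  have h3 : fieldZ (spDilutedGraph d b) (spacingIntVolume d b R') β
      (imgField d b (spCoreConfig d b p R s))
      (.fixed (Function.update (signedCoreAnnulusBC d b p R R' 1 s_out) 0 s)) =
      fieldZ (spDilutedGraph d b) (spacingIntVolume d b R') β (imgField d b (spCoreConfig d b p R s))
      (.fixed fun _ => s_out) :=
    fieldZ_fixed_congr_outerBoundary (spDilutedGraph d b)
      (fun y hy => update_signedCoreAnnulusBC_apply_outerBoundary p R R' s_out s hy) β _
  -- (4) the field tilt from `h⁺` to `h^{η_s}`, supported on the core sites
  have h4 : fieldZ (spDilutedGraph d b) (spacingIntVolume d b R') β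
      (imgField d b (spCoreConfig d b p R s)) (.fixed fun _ => s_out) =
      ∑ τ : ↥(spacingIntVolume d b R') → ℤˣ,
        fieldWeight (spDilutedGraph d b) (spacingIntVolume d b R') β (imgField d b 1)
          (.fixed fun _ => s_out) τ *
        spCoreTilt d b p R β s (glue (spacingIntVolume d b R') τ (.fixed fun _ => s_out)) := by
    unfold fieldZ
    refine Finset.sum_congr rfl fun τ _ => ?_
    rw [fieldWeight_field_tilt (spDilutedGraph d b) (spacingIntVolume d b R') β (imgField d b 1)
      (imgField d b (spCoreConfig d b p R s)) (.fixed fun _ => s_out) τ]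
    have hsum : ∑ x ∈ spacingIntVolume d b R',
        (imgField d b (spCoreConfig d b p R s) x - imgField d b 1 x) *
          spinAt x (glue (spacingIntVolume d b R') τ (.fixed fun _ => s_out)) =
        ∑ x ∈ spCoreSites d b R,
          (imgField d b (spCoreConfig d b p R s) x - imgField d b 1 x) *
            spinAt x (glue (spacingIntVolume d b R') τ (.fixed fun _ => s_out)) := by
      symm
      refine Finset.sum_subset (spCoreSites_subset_spacingIntVolume hb hRR') fun x _ hxK => ?_
      rw [imgField_spCoreConfig_eq_of_notMem (by omega) p s hxK, sub_self, zero_mul]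
    rw [hsum]
    rfl
  -- (5) the tilted sum is `Z⁺ ⟨T_s⟩`
  have h5 := fieldExpect_eq_sum_div (spDilutedGraph d b) (spacingIntVolume d b R') β
    (imgField d b 1) (.fixed fun _ => s_out) (measurable_spCoreTilt (d := d) b p R β s)
  rw [h1, h2, h3, h4, h5, mul_div_cancel₀ _ (fieldZ_pos _ _ _ _ _).ne']

/-- **`⟨σ_0⟩_{W(R')}` in the periodic system**: for `b ≥ 2`, `R' ≥ R + 1` and the exterior value
`s_out`, `⟨σ_0⟩^{ζ_{R'}}_{ℤ^d;W(R');β,0} = (⟨T₊⟩ - ⟨T₋⟩)/(⟨T₊⟩ + ⟨T₋⟩)` with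
`⟨·⟩ = ⟨·⟩^{s_out}_{𝔻_b;Λ^int_{R'};β,h⁺}` (unfixing identity and the tilt representation of `Z_±`,
the common factor `Z^{s_out}_{𝔻_b;Λ^int_{R'};β,h⁺} > 0` cancelling).
[cite: VanenterFernandezSokal1993, §4.1.2 Step 3 and §4.3.1 Step 2.2] -/
theorem isingExpect_spinAt_zero_eq_tilt_ratio {b : ℕ} (hb : 2 ≤ b) (p : ℤˣ) {R R' : ℕ}
    (hRR' : R + 1 ≤ R') (β : ℝ) (s_out : ℤˣ) :
    isingExpect (zdGraph d) (spacingVolume d b R') β 0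
        (.fixed (signedCoreAnnulusBC d b p R R' 1 s_out)) (spinAt 0) =
      (fieldExpect (spDilutedGraph d b) (spacingIntVolume d b R') β (imgField d b 1)
          (.fixed fun _ => s_out) (spCoreTilt d b p R β 1) -
        fieldExpect (spDilutedGraph d b) (spacingIntVolume d b R') β (imgField d b 1)
          (.fixed fun _ => s_out) (spCoreTilt d b p R β (-1))) /
      (fieldExpect (spDilutedGraph d b) (spacingIntVolume d b R') β (imgField d b 1)
          (.fixed fun _ => s_out) (spCoreTilt d b p R β 1) +
        fieldExpect (spDilutedGraph d b) (spacingIntVolume d b R') β (imgField d b 1)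
          (.fixed fun _ => s_out) (spCoreTilt d b p R β (-1))) := by
  have hR' : 1 ≤ R' := by omega
  rw [isingExpect_spinAt_zero_spacingVolume_eq hb hR',
    isingPartitionFunction_update_eq_fieldZ_mul hb p hRR' β s_out 1,
    isingPartitionFunction_update_eq_fieldZ_mul hb p hRR' β s_out (-1), ← mul_sub, ← mul_add,
    mul_div_mul_left _ _ (fieldZ_pos _ _ _ _ _).ne']

/-! ### Screening: the discharge of `VEFS1993_screening` -/

/-- **Steps 2.1–2.2 along `R' → ∞`**: for `b ≥ 2`, `β > 0`, every parity `p` and every `R`, the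
difference of the expectations of `σ_0` in `W(R')` with all-`+` and all-`-` exterior tends to `0`
(both are the ratio `(⟨T₊⟩ - ⟨T₋⟩)/(⟨T₊⟩ + ⟨T₋⟩)` of expectations of core-local observables in the
periodic system `⟨∞;+⟩`, which are insensitive to the `±` boundary condition by uniqueness at the
field sites). [cite: VanenterFernandezSokal1993, §4.3.1 Steps 2.1–2.2 and §4.3.2] -/
theorem tendsto_isingExpect_spinAt_zero_plus_sub_minus {b : ℕ} (hb : 2 ≤ b) {β : ℝ} (hβ : 0 < β)
    (p : ℤˣ) (R : ℕ) :
    Tendsto (fun R' =>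
      isingExpect (zdGraph d) (spacingVolume d b R') β 0
          (.fixed (signedCoreAnnulusBC d b p R R' 1 1)) (spinAt 0) -
        isingExpect (zdGraph d) (spacingVolume d b R') β 0
          (.fixed (signedCoreAnnulusBC d b p R R' 1 (-1))) (spinAt 0)) atTop (𝓝 0) := by
  -- the four sequences `⟨T_s⟩^{±}`
  set E : ℤˣ → ℤˣ → ℕ → ℝ := fun s_out s R' =>
    fieldExpect (spDilutedGraph d b) (spacingIntVolume d b R') β (imgField d b 1)
      (.fixed fun _ => s_out) (spCoreTilt d b p R β s) with hE
  set b₀ : ℝ := Real.exp (-(β * spCoreTiltExp d b R)) with hb₀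
  set B : ℝ := Real.exp (β * spCoreTiltExp d b R) with hB
  have hb₀pos : 0 < b₀ := Real.exp_pos _
  have hEge : ∀ s_out s R', b₀ ≤ E s_out s R' := fun s_out s R' => by
    have := fieldExpect_mono_fun (spDilutedGraph d b) (spacingIntVolume d b R') β (imgField d b 1)
      (.fixed fun _ => s_out) measurable_const (measurable_spCoreTilt b p R β s)
      fun σ => (spCoreTilt_mem_Icc b p R hβ.le s σ).1
    rwa [fieldExpect_const_fun] at this
  have hEle : ∀ s_out s R', E s_out s R' ≤ B := fun s_out s R' => by
    have := fieldExpect_mono_fun (spDilutedGraph d b) (spacingIntVolume d b R') β (imgField d b 1)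
      (.fixed fun _ => s_out) (measurable_spCoreTilt b p R β s) measurable_const
      fun σ => (spCoreTilt_mem_Icc b p R hβ.le s σ).2
    rwa [fieldExpect_const_fun] at this
  -- insensitivity of each `⟨T_s⟩` to the `±` boundary condition
  have hins : ∀ s, Tendsto (fun R' => E 1 s R' - E (-1) s R') atTop (𝓝 0) := fun s =>
    tendsto_per_plus_sub_minus_spacing hb hβ R (measurable_spCoreTilt b p R β s)
      (spCoreTilt_local b p R β s)
  -- the ratios are close
  have hA : ∀ s_out R', |E s_out 1 R' - E s_out (-1) R'| ≤ 2 * B := fun s_out R' => by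
    rw [abs_le]
    constructor <;> linarith [hEge s_out 1 R', hEge s_out (-1) R', hEle s_out 1 R',
      hEle s_out (-1) R', hb₀pos]
  have hden : ∀ s_out R', 2 * b₀ ≤ E s_out 1 R' + E s_out (-1) R' := fun s_out R' => by
    linarith [hEge s_out 1 R', hEge s_out (-1) R']
  have hlim := tendsto_div_sub_div_atTop_nhds_zero (a := fun R' => E 1 1 R' - E 1 (-1) R')
    (a' := fun R' => E (-1) 1 R' - E (-1) (-1) R') (b := fun R' => E 1 1 R' + E 1 (-1) R')
    (b' := fun R' => E (-1) 1 R' + E (-1) (-1) R') (by positivity : (0 : ℝ) < 2 * b₀)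
    (hA 1) (hA (-1)) (hden 1) (hden (-1))
    (by
      have := (hins 1).sub (hins (-1))
      rw [sub_zero] at this
      refine this.congr fun R' => ?_
      ring)
    (by
      have := (hins 1).add (hins (-1))
      rw [add_zero] at this
      refine this.congr fun R' => ?_
      ring)
  refine hlim.congr' ?_
  filter_upwards [eventually_ge_atTop (R + 1)] with R' hR'
  rw [isingExpect_spinAt_zero_eq_tilt_ratio hb p hR' β 1,
    isingExpect_spinAt_zero_eq_tilt_ratio hb p hR' β (-1)]

/-- **van Enter–Fernández–Sokal 1993, §4.3.1 Steps 2.1–2.2 for decimation with spacing `b` —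
discharged** (with threshold `J₁ = 0`: the statement holds at every `β > 0`, as the source remarks,
"in fact the Gibbs measure is unique at all temperatures"). For `d ≥ 2`, `b ≥ 2`, `β > 0`, every
parity `p`, every `R` and `ε > 0` there is `R₀` with
`⟨σ_0⟩^{p±,+,+}_{W(R')} ≤ ⟨σ_0⟩^{p±,+,-}_{W(R')} + ε` for all `R' ≥ R₀`. Proof: unfix the origin
(`⟨σ_0⟩ = (Z₊-Z₋)/(Z₊+Z₋)`), pass to the `b`-diluted internal-spin system with the field of the
frozen image spins, write `Z_± = Z⁺·⟨T_±⟩` as tilts of the periodic all-`+` system (the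
finite-volume perturbation of Step 2.2), and use the insensitivity of core-local observables to the
`±` boundary condition, which follows from uniqueness at the field sites (GHS concavity and
convexity of the free energy, `exists_volume_plusMag_sub_minusMag_le`) by the FKG trick.
[cite: VanenterFernandezSokal1993, §4.3.1 Steps 2.1–2.2 and §4.3.2] -/
theorem VEFS1993_screening_holds : VEFS1993_screening := by
  intro d b _hd hb
  refine ⟨0, fun β hβ p R ε hε => ?_⟩
  have hlim := tendsto_isingExpect_spinAt_zero_plus_sub_minus (d := d) hb hβ p R
  obtain ⟨R₀, hR₀⟩ := Metric.tendsto_atTop.1 hlim ε hε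
  refine ⟨R₀, fun R' hR' => ?_⟩
  have h := hR₀ R' hR'
  rw [Real.dist_eq, sub_zero] at h
  linarith [(abs_lt.1 h).2]

end Literature.Barriers.CriticalPhenomena.NonGibbs

end
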